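import Mathlib
import Literature.Analysis.SpecialFunctions.SphericalBesselFunctions
import HarnessLib

/-!
# Products of Legendre polynomials: Adams–Neumann linearisation, the integral of three Legendre
# polynomials, and the exact `T^P` / `T^S` angular tables

Literature anchor for the engines' `cap.special.tables` (engines release `cap` 0.2.24, module version
`cap.special.tables/0.1.0`): EXACT (rational) Legendre / Chebyshev algebra and the angular
triple-product tables

  `T^P_L[l,l'] = ∫_{-1}^1 P_l P_{l'} T_{2L}`,  `T^S_L[l,l'] = ∫_{-1}^1 (1-μ²) P'_l P'_{l'} T_{2L}`

(`P` = Legendre, `T` = Chebyshev of the first kind), computed by the program by TWO INDEPENDENT EXACT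
METHODS that must agree bit for bit — METHOD R (the three-term recurrences as OPERATORS on Legendre
coefficient vectors: `J` = multiplication by `μ`, `T_{m+1}(J) = 2 J T_m(J) - T_{m-1}(J)`) and
METHOD G (closed forms only: monomial coefficients of `T_{2L}`, monomials in the Legendre basis, and
the Adams–Neumann–Gaunt integral `∫ P_a P_b P_c = 2 (a b c; 0 0 0)²` with the factorial closed form of
the squared `3j`-symbol).  HONEST FRAMING: the engines are shared numerical code serving client
cells; rigour lives in the verifiers; every published number belongs to a client cell's ledger, not
to the engines group.  This file certifies the MATHEMATICS both methods rely on — every recurrence,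
closed form and structural identity the program uses or asserts is a theorem below about the tree's
Rodrigues `legendre n` and Mathlib's `Polynomial.Chebyshev.T ℝ n` — not any run of the code.  Every
public declaration is a published statement (or a routine special case of one) with its source; the
dictionary lets a verifier match each program step to a theorem.

The organising object is the **Legendre coefficient functional**
`λ_c(R) = (2c+1)/2 ∫_{-1}^1 R P_c` (`legendreCoeff`), for which `R = Σ_c λ_c(R) P_c`
(`eq_sum_legendreCoeff`, from the tree's orthogonality `integral_legendre_mul_legendre`).  Bonnet's
recursion read as the multiplication operator, `λ_c(x R) = c/(2c-1) λ_{c-1}(R) + (c+1)/(2c+3) λ_{c+1}(R)`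
(`legendreCoeff_X_mul`), IS the program's `mul_mu`; iterating it along `(b+1) P_{b+1} = (2b+1) x P_b - b P_{b-1}`
and matching the three-term recurrence of the closed form (`adamsCoeff_rec`, proved from the ratio
structure of `(a b c; 0 0 0)²` in Racah's variables `s-a, s-b, s-c`) gives the Adams–Neumann
linearisation `λ_c(P_a P_b) = (2c+1) (a b c; 0 0 0)²` (`legendreCoeff_legendre_mul_legendre`) by
induction on `b`, whence `∫ P_a P_b P_c = 2 (a b c; 0 0 0)²` and the symmetries of the squared
`3j`-symbol.  Neither Mathlib nor the tree had the linearisation formula, the `3j`-symbol, the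
monomial coefficients of `T_m`, or the monomial ↔ Legendre change of basis as identities of
polynomials (the tree has the moments `∫ t^{n+2k} P_n`, `legendreMoment_add_two_mul`, which we reuse).

## Sources (statements checked against the cited formulas)

* `DLMF` 34.2.4–34.2.5 and 34.3.5 (the `3j`-symbol `(j₁ j₂ j₃; 0 0 0)`: zero for `J = j₁+j₂+j₃` odd,
  and for `J` even `= (-1)^{J/2} [(J-2j₁)!(J-2j₂)!(J-2j₃)!/(J+1)!]^{½} (J/2)!/((J/2-j₁)!(J/2-j₂)!(J/2-j₃)!)`),
  34.3.8–34.3.10 (symmetries), 34.3.19 (`P_{l₁} P_{l₂} = Σ_l (2l+1) (l₁ l₂ l; 0 0 0)² P_l`), 34.3.21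
  (`∫_0^π P_{l₁} P_{l₂} P_{l₃} sin θ dθ = 2 (l₁ l₂ l₃; 0 0 0)²`), 34.3.22 (Gaunt's integral; `m = 0`);
  18.9.1–18.9.2 (three-term recurrences `x p_n = …` for Legendre and Chebyshev), 18.18.17 (monomials in
  ultraspherical polynomials, `λ = ½`) — as the program cites them.
* `BiedenharnLouck1984` §3.11, p. 91: (3.190)–(3.195) (the integral of three rotation matrices, the
  triangle and parity conditions (3.191)/(3.195), `∫_0^π P_l P_{l₁} P_{l₂} sin β dβ = (2/(2l+1)) (C^{l₁l₂l}_{000})²`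
  (3.193), and Racah's closed form (3.194) of `C^{l₁ l₂ l}_{000}`; `(2c+1)(a b c;000)² = (C^{abc}_{000})²`).
* `Adams1878` (the linearisation of `P_a P_b`, "Adams–Neumann"); `Assche2020` (Ismail–Van Assche,
  *Askey–Bateman project* vol. 1) §3.7, p. 65: (3.7.6) orthogonality, (3.7.9)
  `(1-x²) P'_n = (n(n+1)/(2n+1)) (P_{n-1} - P_{n+1})`, (3.7.18) the linearisation with non-negative
  coefficients.
* `Arfken1985` (3rd ed.), ch. 12: (12.8) (p. 486) `P_n(x) = Σ_{k≤n/2} (-1)^k (2n-2k)!/(2ⁿ k!(n-k)!(n-2k)!) x^{n-2k}`,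
  (12.17) Bonnet's recursion, (12.23) `P'_{n+1} - P'_{n-1} = (2n+1) P_n`, (12.26)
  `(1-x²) P'_n = n P_{n-1} - n x P_n`, (12.28) Legendre's equation, (12.37) parity, (12.64)–(12.64a)
  (Rodrigues' expansion with the sum extended to `n`), Exercises 12.4.3–12.4.6 (p. 665:
  `∫ x^m P_n = 0` for `m < n`, the moments, and `x^s` in the Legendre basis).
* `AbramowitzStegun1964` 22.3.6 (`T_n(x) = (n/2) Σ_{m≤n/2} (-1)^m (n-m-1)!/(m!(n-2m)!) (2x)^{n-2m}`),
  22.3.8 (explicit `P_n`); `AndrewsAskeyRoy1999` (2.5.14) (orthogonality), Cor. 2.5.3;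
  `Jeffrey1995` §18.2.5.1 (1) (Bonnet, via the tree's `legendre_succ_succ`).
* Mathlib: `Polynomial.Chebyshev.T_add_two` (`T_{n+2} = 2X T_{n+1} - T_n`), `Chebyshev.T_eval_neg`,
  `Chebyshev.natDegree_T`; the tree: `integral_legendre_mul_legendre` (norms), `eval_neg_legendre`,
  `X_sq_sub_one_mul_derivative_legendre`, `derivative_legendre_add_two_sub`, `legendreMoment_add_two_mul`,
  `integral_derivative_mul` (integration by parts on `[-1,1]`).

## Dictionary to `engines/eng-cap-1/release/cap-0.2.24/cap/special/tables.py`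

* A Legendre coefficient vector `v = [v_0, …]` (the polynomial `Σ_j v_j P_j`) ↔ `R : ℝ[X]` with
  `v_j = legendreCoeff R j` (`eq_sum_legendreCoeff`, `legendreCoeff_sum_C_mul_legendre`,
  `eq_of_legendreCoeff_eq`: the vector determines the polynomial); `_unit(a)` ↔ `legendre a`
  (`legendreCoeff_legendre`); `_trim` drops zero entries (`legendreCoeff_eq_zero_of_natDegree_lt`).
* METHOD R.  `mul_mu(v)` (`μ P_j = ((j+1) P_{j+1} + j P_{j-1})/(2j+1)`) ↔ `X_mul_legendre` and, on
  coefficient vectors, `legendreCoeff_X_mul` (`out[j+1] += c (j+1)/(2j+1)`, `out[j-1] += c j/(2j+1)`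
  is exactly `λ_c(xR) = c/(2c-1) λ_{c-1}(R) + (c+1)/(2c+3) λ_{c+1}(R)` read column-wise);
  `chebyshev_T_apply(m, v)` (`t2 = 2*mul_mu(t1) - t0`) ↔ `legendreCoeff_chebyshev_T_add_two_mul`
  (`λ_c(T_{m+2} R) = 2 λ_c(x T_{m+1} R) - λ_c(T_m R)`, Mathlib's `Chebyshev.T_add_two`), with
  `T_0 R = R`, `T_1 R = x R`; `triple_TP(L, l, lp) = (2/(2l'+1)) t[lp]` ↔
  `integral_legendre_mul_legendre_mul` (`∫ P_a P_b Q = (2/(2b+1)) λ_b(Q P_a)`, `Q = T_{2L}`);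
  `triple_TS` (`(2l(l+1)/(2l+1)) Σ_{j<l', j≡l'-1 (2)} (lo[j] - hi[j])`, `lo/hi = T_{2L}(J) e_{l∓1}`,
  `0` if `l = 0` or `l' = 0`) ↔ `integral_one_sub_sq_mul_derivative_legendre_mul` (for `l = 0` the
  prefactor, for `l' = 0` the empty sum gives `0`; note `legendre (0 - 1) = legendre 0` is harmless
  there), built from the two identities the module docstring quotes and "also checks exactly":
  `(1-μ²) P'_l = (l(l+1)/(2l+1)) (P_{l-1} - P_{l+1})` ↔ `one_sub_X_sq_mul_derivative_legendre`,
  `P'_n = Σ_{j<n, j≡n-1 (2)} (2j+1) P_j` ↔ `derivative_legendre_eq_sum_filter` /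
  `derivative_legendre_eq_sum` / `legendreCoeff_derivative_legendre`.
* METHOD G.  `legendre_monomial_coeffs(n)` (`c[n-2k] = (-1)^k C(n,k) C(2n-2k,n)/2ⁿ`, `k ≤ n/2`) ↔
  `legendre_eq_sum_monomial'` (and `legendre_eq_sum_monomial`, the sum to `n` with vanishing tail);
  `chebyshev_monomial_coeffs(m)` (`c[m-2k] = (-1)^k · m (m-k-1)! 2^{m-2k}/(2 k! (m-2k)!)`, `m ≥ 1`;
  `[1]` for `m = 0`) ↔ `chebyshevMonomialCoeff`, `chebyshev_T_eq_sum_monomial`, `coeff_chebyshev_T`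
  (`m ≥ 1`; `T_0 = 1` is Mathlib's `Chebyshev.T_zero`) — in particular the quotient the program forms
  is the coefficient (its integrality check is a runtime assertion, not used here);
  `monomial_in_legendre(k)` (`a[j] = (2j+1) k!/(2^h h! (k+j+1)!!)`, `h = (k-j)/2`, `j ≡ k (2)`) ↔
  `monomialLegendreCoeff`, `legendreCoeff_X_pow`, `X_pow_eq_sum_legendre`
  (`legendreCoeff_X_pow_add_two_mul`, `…_eq_zero_of_lt`, `…_eq_zero_of_odd`);
  `chebyshev_in_legendre(m)` (`g[j] += c_k a_{k,j}`) ↔ `legendreCoeff_eq_sum_coeff_mul`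
  (`λ_j(Q) = Σ_k Q_k a_{k,j}` for any `Q`, here `Q = T_{2L}`); `three_j_zero_sq(a,b,c)` ↔
  `threeJZeroSq` with `threeJZeroSq_eq_factorial` (the program's factorial expression, `J` even and
  triangle) and `threeJZeroSq_eq_zero_of_mod_two` / `_of_lt₁₋₃` (its `return 0` branches; negative
  indices do not occur in `ℕ` — see `triple_TS` above); `gaunt(a,b,c) = 2·three_j_zero_sq` ↔
  `integral_legendre_mul_legendre_mul_legendre` (`∫_{-1}^1 P_a P_b P_c = 2 (a b c; 0 0 0)²`);
  `legendre_product_in_legendre(a,b)` (`h_c = (2c+1) (a b c;0 0 0)²`, `c ≤ a+b`) ↔ `adamsCoeff`,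
  `legendre_mul_legendre` (`P_a P_b = Σ_{c≤a+b} h_c P_c`), `legendreCoeff_legendre_mul_legendre`;
  `triple_TP_gaunt` (`Σ_j g_j gaunt(l,l',j)`) ↔ `integral_legendre_mul_legendre_mul_eq_sum_threeJZeroSq`;
  `triple_TS_gaunt` (`(l(l+1)/(2l+1)) Σ_j (2j+1) Σ_i g_i [gaunt(l-1,j,i) - gaunt(l+1,j,i)]`) ↔
  `integral_one_sub_sq_mul_derivative_legendre_mul_eq_sum_threeJZeroSq`.
* `crosscheck_tables`: "R == G" is the statement that both sides above equal the same integral; the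
  structural assertions ↔ `integral_legendre_mul_legendre_mul_chebyshev_T` (T^P: symmetry `l ↔ l'`,
  selection rule `|l-l'| ≤ 2L`, parity `l+l'` even, `L = 0` values `2/(2l+1) δ_{ll'}`) and
  `integral_one_sub_sq_mul_derivative_legendre_mul_chebyshev_T` (T^S: the same, `L = 0` values
  `2l(l+1)/(2l+1) δ_{ll'}` from Legendre's equation `derivative_one_sub_X_sq_mul_derivative_legendre`
  by parts, `integral_one_sub_sq_mul_derivative_legendre_mul_derivative_legendre`); the rules come from
  `integral_legendre_mul_legendre_mul_eq_zero_of_lt` (orthogonality), `…_eq_zero_of_odd` (parity) and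
  `eval_neg_chebyshev_T_two_mul` (`T_{2L}` is even).  `double_factorial(n)` ↔ `Nat.doubleFactorial`.

## Main statements

* `legendreCoeff`, `eq_sum_legendreCoeff`, `legendreCoeff_X_mul` (Bonnet as the operator `μ·`),
  `legendreCoeff_chebyshev_T_add_two_mul`;
* `threeJZeroSq` (`(a b c; 0 0 0)²`), `threeJZeroSq_eq_factorial`, `threeJZeroSq_comm₁₂`,
  `threeJZeroSq_comm₂₃`, `adamsCoeff`, `adamsCoeff_rec`, `adamsCoeff_nonneg`;
* `legendreCoeff_legendre_mul_legendre` and `legendre_mul_legendre` (Adams–Neumann: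
  `P_a P_b = Σ_c (2c+1) (a b c; 0 0 0)² P_c`), `integral_legendre_mul_legendre_mul_legendre`
  (`∫_{-1}^1 P_a P_b P_c = 2 (a b c; 0 0 0)²`);
* `legendre_eq_sum_monomial` (A&S 22.3.8), `X_pow_eq_sum_legendre` with `monomialLegendreCoeff`,
  `chebyshev_T_eq_sum_monomial` with `chebyshevMonomialCoeff` (A&S 22.3.6), `legendreCoeff_eq_sum_coeff_mul`;
* `one_sub_X_sq_mul_derivative_legendre`, `derivative_legendre_eq_sum`,
  `derivative_one_sub_X_sq_mul_derivative_legendre` (Legendre's equation),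
  `integral_one_sub_sq_mul_derivative_legendre_mul_derivative_legendre`;
* `integral_legendre_mul_legendre_mul`, `integral_legendre_mul_legendre_mul_eq_sum_threeJZeroSq`,
  `integral_one_sub_sq_mul_derivative_legendre_mul`,
  `integral_one_sub_sq_mul_derivative_legendre_mul_eq_sum_threeJZeroSq` (the two methods for `T^P`, `T^S`),
  `integral_legendre_mul_legendre_mul_chebyshev_T`, `integral_one_sub_sq_mul_derivative_legendre_mul_chebyshev_T`
  (the structural identities).
-/

open Polynomial intervalIntegral MeasureTheory Finset
open scoped Nat

namespace Literature.Analysis.SpecialFunctions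

/-! ### Bonnet's recursion as the multiplication operator `μ ·` on the Legendre basis -/

/-- Bonnet's recursion for every index: `(b+1) P_{b+1} = (2b+1) X P_b - b P_{b-1}` (at `b = 0` the
last term is absent). [cite: Jeffrey1995, §18.2.5.1 (1)] -/
theorem legendre_bonnet (b : ℕ) :
    C ((b : ℝ) + 1) * legendre (b + 1) =
      C (2 * (b : ℝ) + 1) * X * legendre b - C (b : ℝ) * legendre (b - 1) := by
  rcases b with _ | n
  · simp [legendre_zero, legendre_one]
  · have h := legendre_succ_succ n
    push_cast
    rw [show (n : ℝ) + 1 + 1 = n + 2 by ring, show 2 * ((n : ℝ) + 1) + 1 = 2 * n + 3 by ring]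
    exact h

/-- **Multiplication by `x` on the Legendre basis**:
`x P_c = ((c+1) P_{c+1} + c P_{c-1}) / (2c+1)` (Bonnet's recursion solved for `x P_c`; the
`c = 0` case reads `x P_0 = P_1`). [cite: DLMF, 18.9.1 with 18.9.2 (Legendre case); Arfken1985, (12.17)] -/
theorem X_mul_legendre (c : ℕ) :
    X * legendre c =
      C (((c : ℝ) + 1) / (2 * c + 1)) * legendre (c + 1) + C ((c : ℝ) / (2 * c + 1)) * legendre (c - 1) := by
  have h := legendre_bonnet c
  have hc : (2 * (c : ℝ) + 1) ≠ 0 := by positivity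
  apply Polynomial.funext
  intro x
  have h' := congrArg (fun p => p.eval x) h
  simp only [eval_mul, eval_C, eval_X, eval_sub, eval_add] at h' ⊢
  rw [div_mul_eq_mul_div, div_mul_eq_mul_div, ← add_div, eq_div_iff hc]
  linear_combination -h'

/-! ### The Legendre coefficient functional -/

/-- The `c`-th **Legendre coefficient** of a polynomial `R`:
`λ_c(R) = (2c+1)/2 · ∫_{-1}^1 R(x) P_c(x) dx`, so that `R = Σ_c λ_c(R) P_c`
(`eq_sum_legendreCoeff`). [cite: Arfken1985, (12.50)–(12.51)] -/
noncomputable def legendreCoeff (R : ℝ[X]) (c : ℕ) : ℝ :=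
  (2 * c + 1) / 2 * ∫ x in (-1 : ℝ)..1, R.eval x * (legendre c).eval x

/-- `∫_{-1}^1 R P_c = (2/(2c+1)) λ_c(R)`. [cite: Arfken1985, (12.50)] -/
theorem integral_mul_legendre_eq_legendreCoeff (R : ℝ[X]) (c : ℕ) :
    ∫ x in (-1 : ℝ)..1, R.eval x * (legendre c).eval x = 2 / (2 * c + 1) * legendreCoeff R c := by
  have hc : (2 * (c : ℝ) + 1) ≠ 0 := by positivity
  unfold legendreCoeff
  field_simp

/-- Polynomial products are interval integrable. [folklore] -/
private theorem ii (R S : ℝ[X]) :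
    IntervalIntegrable (fun x => R.eval x * S.eval x) volume (-1 : ℝ) 1 :=
  (R.continuous.mul S.continuous).intervalIntegrable _ _

/-- `λ_c` is additive. [cite: Arfken1985, (12.50) (linearity of the finite Legendre transform)] -/
theorem legendreCoeff_add (R S : ℝ[X]) (c : ℕ) :
    legendreCoeff (R + S) c = legendreCoeff R c + legendreCoeff S c := by
  unfold legendreCoeff
  simp only [eval_add, add_mul]
  rw [intervalIntegral.integral_add (ii R _) (ii S _)]
  ring

/-- `λ_c` is homogeneous. [cite: Arfken1985, (12.50) (linearity of the finite Legendre transform)] -/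
theorem legendreCoeff_C_mul (a : ℝ) (R : ℝ[X]) (c : ℕ) :
    legendreCoeff (C a * R) c = a * legendreCoeff R c := by
  unfold legendreCoeff
  simp only [eval_mul, eval_C, mul_assoc]
  rw [intervalIntegral.integral_const_mul]
  ring

/-- `λ_c(0) = 0`. [cite: Arfken1985, (12.50) (linearity of the finite Legendre transform)] -/
theorem legendreCoeff_zero (c : ℕ) : legendreCoeff 0 c = 0 := by
  simp [legendreCoeff]

/-- `λ_c(-R) = -λ_c(R)`. [cite: Arfken1985, (12.50) (linearity of the finite Legendre transform)] -/
theorem legendreCoeff_neg (R : ℝ[X]) (c : ℕ) : legendreCoeff (-R) c = -legendreCoeff R c := by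
  have h := legendreCoeff_C_mul (-1) R c
  rwa [show C (-1 : ℝ) * R = -R by simp, neg_one_mul] at h

/-- `λ_c(R - S) = λ_c(R) - λ_c(S)`. [cite: Arfken1985, (12.50) (linearity of the finite Legendre transform)] -/
theorem legendreCoeff_sub (R S : ℝ[X]) (c : ℕ) :
    legendreCoeff (R - S) c = legendreCoeff R c - legendreCoeff S c := by
  rw [sub_eq_add_neg, legendreCoeff_add, legendreCoeff_neg, ← sub_eq_add_neg]

/-- `λ_c` of a finite sum. [cite: Arfken1985, (12.50) (linearity of the finite Legendre transform)] -/
theorem legendreCoeff_sum {ι : Type*} (s : Finset ι) (f : ι → ℝ[X]) (c : ℕ) :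
    legendreCoeff (∑ i ∈ s, f i) c = ∑ i ∈ s, legendreCoeff (f i) c := by
  classical
  induction s using Finset.induction_on with
  | empty => simp [legendreCoeff_zero]
  | insert i s hi ih => rw [sum_insert hi, sum_insert hi, legendreCoeff_add, ih]

/-- **Orthonormalisation**: `λ_c(P_j) = δ_{jc}`. [cite: AndrewsAskeyRoy1999, (2.5.14) (α = β = 0)] -/
theorem legendreCoeff_legendre (j c : ℕ) :
    legendreCoeff (legendre j) c = if j = c then 1 else 0 := by
  unfold legendreCoeff
  rw [integral_legendre_mul_legendre j c]
  split_ifs with h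
  · subst h
    have hc : (2 * (j : ℝ) + 1) ≠ 0 := by positivity
    field_simp
  · simp

/-- The coefficients of a Legendre combination: `λ_c(Σ_{j<N} f_j P_j) = f_c` (`c < N`), else `0`.
[cite: Arfken1985, (12.49)–(12.51) (uniqueness of the Legendre series, p. 654)] -/
theorem legendreCoeff_sum_C_mul_legendre (f : ℕ → ℝ) (N c : ℕ) :
    legendreCoeff (∑ j ∈ range N, C (f j) * legendre j) c = if c < N then f c else 0 := by
  rw [legendreCoeff_sum]
  simp_rw [legendreCoeff_C_mul, legendreCoeff_legendre, mul_ite, mul_one, mul_zero]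
  rw [sum_ite_eq' (range N) c f]
  simp

/-- **Legendre expansion**: a polynomial of degree `≤ n` is `Σ_{c ≤ n} λ_c(R) P_c`.
[cite: Arfken1985, (12.50)–(12.51)] -/
theorem eq_sum_legendreCoeff {R : ℝ[X]} {n : ℕ} (hR : R.natDegree ≤ n) :
    R = ∑ c ∈ range (n + 1), C (legendreCoeff R c) * legendre c := by
  obtain ⟨α, hα⟩ := exists_eq_sum_C_mul_legendre n R hR
  have hcoef : ∀ c ∈ range (n + 1), legendreCoeff R c = α c := by
    intro c hc
    rw [hα, legendreCoeff_sum_C_mul_legendre, if_pos (mem_range.mp hc)]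
  conv_lhs => rw [hα]
  exact sum_congr rfl fun c hc => by rw [hcoef c hc]

/-- `λ_c(R) = 0` when `deg R < c`. [cite: AndrewsAskeyRoy1999, (2.5.14) (α = β = 0)] -/
theorem legendreCoeff_eq_zero_of_natDegree_lt {R : ℝ[X]} {c : ℕ} (h : R.natDegree < c) :
    legendreCoeff R c = 0 := by
  have h' := integral_legendre_mul_eq_zero (n := c) (q := R)
    ((degree_le_natDegree).trans_lt (by exact_mod_cast h))
  unfold legendreCoeff
  rw [show (∫ x in (-1 : ℝ)..1, R.eval x * (legendre c).eval x) = 0 from by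
    rw [← h']; exact intervalIntegral.integral_congr fun x _ => mul_comm _ _]
  simp

/-- Two polynomials of degree `≤ n` with the same Legendre coefficients are equal. [cite: Arfken1985, (12.49)–(12.51) (uniqueness of the Legendre series, p. 654)] -/
theorem eq_of_legendreCoeff_eq {R S : ℝ[X]} {n : ℕ} (hR : R.natDegree ≤ n) (hS : S.natDegree ≤ n)
    (h : ∀ c ≤ n, legendreCoeff R c = legendreCoeff S c) : R = S := by
  rw [eq_sum_legendreCoeff hR, eq_sum_legendreCoeff hS]
  exact sum_congr rfl fun c hc => by rw [h c (Nat.lt_succ_iff.mp (mem_range.mp hc))]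

/-- `2c - 1 ≠ 0` for a natural number `c` (cast to `ℝ`). [folklore] -/
private theorem two_mul_sub_one_ne_zero (c : ℕ) : (2 * (c : ℝ) - 1) ≠ 0 := by
  intro h
  have h2 : (2 * c : ℝ) = 1 := by linarith
  norm_cast at h2
  omega

/-- **The multiplication operator in the Legendre basis** (the program's `mul_mu`):
`λ_c(x R) = c/(2c-1) · λ_{c-1}(R) + (c+1)/(2c+3) · λ_{c+1}(R)`.
[cite: DLMF, 18.9.1 with 18.9.2 (Legendre case)] -/
theorem legendreCoeff_X_mul (R : ℝ[X]) (c : ℕ) :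
    legendreCoeff (X * R) c =
      (c : ℝ) / (2 * c - 1) * legendreCoeff R (c - 1) +
        ((c : ℝ) + 1) / (2 * c + 3) * legendreCoeff R (c + 1) := by
  have hint : (∫ x in (-1 : ℝ)..1, (X * R).eval x * (legendre c).eval x) =
      ((c : ℝ) + 1) / (2 * c + 1) * (∫ x in (-1 : ℝ)..1, R.eval x * (legendre (c + 1)).eval x) +
        (c : ℝ) / (2 * c + 1) * (∫ x in (-1 : ℝ)..1, R.eval x * (legendre (c - 1)).eval x) := by
    have hx : ∀ x : ℝ, (X * R).eval x * (legendre c).eval x =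
        ((c : ℝ) + 1) / (2 * c + 1) * (R.eval x * (legendre (c + 1)).eval x) +
          (c : ℝ) / (2 * c + 1) * (R.eval x * (legendre (c - 1)).eval x) := by
      intro x
      have h := congrArg (fun p => p.eval x) (X_mul_legendre c)
      simp only [eval_mul, eval_X, eval_add, eval_C] at h ⊢
      rw [show x * R.eval x * (legendre c).eval x = R.eval x * (x * (legendre c).eval x) by ring, h]
      ring
    simp_rw [hx]
    rw [intervalIntegral.integral_add ((ii _ _).const_mul _) ((ii _ _).const_mul _),
      intervalIntegral.integral_const_mul, intervalIntegral.integral_const_mul]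
  unfold legendreCoeff
  rw [hint]
  have h1 : (2 * (c : ℝ) + 1) ≠ 0 := by positivity
  have h3 : (2 * (c : ℝ) + 3) ≠ 0 := by positivity
  rcases c with _ | n
  · simp
    field_simp
    ring
  · have h2 := two_mul_sub_one_ne_zero (n + 1)
    push_cast at h1 h2 h3 ⊢
    field_simp
    ring

/-! ### The squared 3j-symbol `(a b c; 0 0 0)²` and the Adams–Neumann coefficients -/

/-- `w(x,y,z) = C(2x,x) C(2y,y) C(2z,z) / ((2s+1) C(2s,s))`, `s = x+y+z`: Racah's single-term form of
the squared 3j-symbol `(j₁ j₂ j₃; 0 0 0)²` in the coordinates `x = s - j₁`, `y = s - j₂`, `z = s - j₃`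
(`threeJZeroSq_eq_threeJAux`, `threeJAux_eq_factorial`). [cite: DLMF, 34.3.5] -/
noncomputable def threeJAux (x y z : ℕ) : ℝ :=
  ((x.centralBinom : ℝ) * y.centralBinom * z.centralBinom) /
    ((2 * ((x + y + z : ℕ) : ℝ) + 1) * (x + y + z).centralBinom)

/-- `w(x,y,z) > 0`. [folklore] -/
private theorem threeJAux_pos (x y z : ℕ) : 0 < threeJAux x y z := by
  unfold threeJAux
  have h1 := Nat.centralBinom_pos x
  have h2 := Nat.centralBinom_pos y
  have h3 := Nat.centralBinom_pos z
  have h4 := Nat.centralBinom_pos (x + y + z)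
  positivity

/-- `w` is symmetric (swap of the first two arguments). [folklore] -/
private theorem threeJAux_swap₁₂ (x y z : ℕ) : threeJAux x y z = threeJAux y x z := by
  unfold threeJAux; rw [show y + x + z = x + y + z by ring]; ring

/-- `w` is symmetric (swap of the outer arguments). [folklore] -/
private theorem threeJAux_swap₁₃ (x y z : ℕ) : threeJAux x y z = threeJAux z y x := by
  unfold threeJAux; rw [show z + y + x = x + y + z by ring]; ring

/-- `C(2n+2, n+1) = 2(2n+1)/(n+1) · C(2n, n)` in `ℝ`. [folklore] -/
private theorem cast_centralBinom_succ (n : ℕ) :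
    (((n + 1).centralBinom : ℕ) : ℝ) = 2 * (2 * n + 1) / (n + 1) * n.centralBinom := by
  have h := congrArg (Nat.cast (R := ℝ)) (Nat.succ_mul_centralBinom_succ n)
  push_cast at h
  rw [div_mul_eq_mul_div, eq_div_iff (by positivity)]
  linear_combination h

/-- **The one-step ratio of Racah's form**: `w(x+1,y,z) = (2x+1)(s+1)/((x+1)(2s+3)) · w(x,y,z)`,
`s = x+y+z`. [folklore] -/
private theorem threeJAux_succ₁ (x y z : ℕ) :
    threeJAux (x + 1) y z =
      (2 * (x : ℝ) + 1) * ((x : ℝ) + y + z + 1) / (((x : ℝ) + 1) * (2 * ((x : ℝ) + y + z) + 3)) *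
        threeJAux x y z := by
  unfold threeJAux
  rw [show x + 1 + y + z = x + y + z + 1 by ring, cast_centralBinom_succ, cast_centralBinom_succ]
  push_cast
  have h5 : ((x + y + z).centralBinom : ℝ) ≠ 0 := by exact_mod_cast Nat.centralBinom_ne_zero _
  have h6 : (x.centralBinom : ℝ) ≠ 0 := by exact_mod_cast Nat.centralBinom_ne_zero _
  field_simp
  ring

/-- The ratio in the second argument. [folklore] -/
private theorem threeJAux_succ₂ (x y z : ℕ) :
    threeJAux x (y + 1) z =
      (2 * (y : ℝ) + 1) * ((x : ℝ) + y + z + 1) / (((y : ℝ) + 1) * (2 * ((x : ℝ) + y + z) + 3)) *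
        threeJAux x y z := by
  rw [threeJAux_swap₁₂, threeJAux_succ₁, threeJAux_swap₁₂ y x z]
  ring

/-- The ratio in the third argument. [folklore] -/
private theorem threeJAux_succ₃ (x y z : ℕ) :
    threeJAux x y (z + 1) =
      (2 * (z : ℝ) + 1) * ((x : ℝ) + y + z + 1) / (((z : ℝ) + 1) * (2 * ((x : ℝ) + y + z) + 3)) *
        threeJAux x y z := by
  rw [threeJAux_swap₁₃, threeJAux_succ₁, threeJAux_swap₁₃ z y x]
  ring

/-- `w(0, y, 0) = 1/(2y+1)` (`(j 0 j; 0 0 0)² = 1/(2j+1)`). [cite: DLMF, 34.3.1 with 34.3.5] -/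
theorem threeJAux_zero_zero (y : ℕ) : threeJAux 0 y 0 = 1 / (2 * y + 1) := by
  unfold threeJAux
  have h : (y.centralBinom : ℝ) ≠ 0 := by exact_mod_cast Nat.centralBinom_ne_zero _
  simp only [Nat.centralBinom_zero, Nat.cast_one, one_mul, mul_one, zero_add, add_zero]
  field_simp

/-- **The squared Wigner 3j-symbol `(a b c; 0 0 0)²`** — the program's `three_j_zero_sq(a, b, c)`:
zero unless `a + b + c` is even and `(a, b, c)` satisfy the triangle conditions, and then Racah's
single term with `s = (a+b+c)/2` (`threeJZeroSq_eq_factorial` is the factorial form the program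
evaluates). [cite: DLMF, 34.3.5; BiedenharnLouck1984, (3.191), (3.194)–(3.195)] -/
noncomputable def threeJZeroSq (a b c : ℕ) : ℝ :=
  if Even (a + b + c) ∧ c ≤ a + b ∧ a ≤ b + c ∧ b ≤ c + a then
    threeJAux ((a + b + c) / 2 - a) ((a + b + c) / 2 - b) ((a + b + c) / 2 - c)
  else 0

/-- **Parity rule**: `(a b c; 0 0 0) = 0` for `a + b + c` odd. [cite: BiedenharnLouck1984, (3.195); DLMF, 34.3.5] -/
theorem threeJZeroSq_eq_zero_of_not_even {a b c : ℕ} (h : ¬Even (a + b + c)) :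
    threeJZeroSq a b c = 0 := by
  unfold threeJZeroSq; rw [if_neg fun H => h H.1]

/-- Parity rule, `mod 2` form. [cite: BiedenharnLouck1984, (3.195)] -/
theorem threeJZeroSq_eq_zero_of_mod_two {a b c : ℕ} (h : (a + b + c) % 2 = 1) :
    threeJZeroSq a b c = 0 :=
  threeJZeroSq_eq_zero_of_not_even (by rw [Nat.even_iff]; omega)

/-- **Triangle rule**: `(a b c; 0 0 0) = 0` if `c > a + b`. [cite: BiedenharnLouck1984, (3.191)] -/
theorem threeJZeroSq_eq_zero_of_lt₁ {a b c : ℕ} (h : a + b < c) : threeJZeroSq a b c = 0 := by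
  unfold threeJZeroSq; rw [if_neg]; rintro ⟨-, h1, -, -⟩; omega

/-- Triangle rule: `(a b c; 0 0 0) = 0` if `a > b + c`. [cite: BiedenharnLouck1984, (3.191)] -/
theorem threeJZeroSq_eq_zero_of_lt₂ {a b c : ℕ} (h : b + c < a) : threeJZeroSq a b c = 0 := by
  unfold threeJZeroSq; rw [if_neg]; rintro ⟨-, -, h1, -⟩; omega

/-- Triangle rule: `(a b c; 0 0 0) = 0` if `b > c + a`. [cite: BiedenharnLouck1984, (3.191)] -/
theorem threeJZeroSq_eq_zero_of_lt₃ {a b c : ℕ} (h : c + a < b) : threeJZeroSq a b c = 0 := by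
  unfold threeJZeroSq; rw [if_neg]; rintro ⟨-, -, -, h1⟩; omega

/-- In Racah's coordinates `a = y+z, b = x+z, c = x+y` (every admissible triple is of this form)
`(a b c; 0 0 0)² = w(x,y,z)`. [cite: DLMF, 34.3.5] -/
theorem threeJZeroSq_eq_threeJAux (a b c x y z : ℕ) (ha : a = y + z) (hb : b = x + z)
    (hc : c = x + y) : threeJZeroSq a b c = threeJAux x y z := by
  subst ha hb hc
  unfold threeJZeroSq
  rw [if_pos ⟨⟨x + y + z, by ring⟩, by omega, by omega, by omega⟩]
  congr 1 <;> omega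

/-- `(a b c; 0 0 0)² ≥ 0`. [cite: DLMF, 34.3.5 (a square)] -/
theorem threeJZeroSq_nonneg (a b c : ℕ) : 0 ≤ threeJZeroSq a b c := by
  unfold threeJZeroSq
  split_ifs
  · exact (threeJAux_pos _ _ _).le
  · exact le_rfl

/-- **The Adams–Neumann linearisation coefficient** `h(a,b,c) = (2c+1) (a b c; 0 0 0)²`
(`= (C^{a b c}_{0 0 0})²`, a squared Clebsch–Gordan coefficient) — the entries of the program's
`legendre_product_in_legendre(a, b)`. [cite: DLMF, 34.3.19 with 34.3.5; Adams1878, pp. 63–71] -/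
noncomputable def adamsCoeff (a b c : ℕ) : ℝ := (2 * c + 1) * threeJZeroSq a b c

/-- `h(a,b,c) = 0` for `c > a + b`. [cite: BiedenharnLouck1984, (3.191)] -/
theorem adamsCoeff_eq_zero_of_lt {a b c : ℕ} (h : a + b < c) : adamsCoeff a b c = 0 := by
  rw [adamsCoeff, threeJZeroSq_eq_zero_of_lt₁ h, mul_zero]

/-- `h(a, 0, c) = δ_{ac}` (`P_a · P_0 = P_a`). [cite: DLMF, 34.3.1 (squared: `(a 0 c; 0 0 0)² = δ_{ac}/(2a+1)`)] -/
theorem adamsCoeff_zero_mid (a c : ℕ) : adamsCoeff a 0 c = if a = c then 1 else 0 := by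
  unfold adamsCoeff
  split_ifs with h
  · subst h
    rw [threeJZeroSq_eq_threeJAux a 0 a 0 a 0 (by simp) (by simp) (by simp), threeJAux_zero_zero]
    have : (2 * (a : ℝ) + 1) ≠ 0 := by positivity
    field_simp
  · rcases Nat.lt_or_gt_of_ne h with h' | h'
    · rw [threeJZeroSq_eq_zero_of_lt₁ (by simpa using h'), mul_zero]
    · rw [threeJZeroSq_eq_zero_of_lt₂ (by simpa using h'), mul_zero]

/-- **The Bonnet recursion of the linearisation coefficients** (the identity that drives the
induction in `legendreCoeff_legendre_mul_legendre`; all degenerate positions included):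
`(b+1) h(a,b+1,c) = (2b+1) [c/(2c-1) h(a,b,c-1) + (c+1)/(2c+3) h(a,b,c+1)] - b h(a,b-1,c)`.
[cite: DLMF, 34.3.19 with 18.9.1–18.9.2 (the coefficients of `x · P_a P_b`); Adams1878, pp. 63–71] -/
theorem adamsCoeff_rec (a b c : ℕ) :
    ((b : ℝ) + 1) * adamsCoeff a (b + 1) c =
      (2 * (b : ℝ) + 1) * ((c : ℝ) / (2 * c - 1) * adamsCoeff a b (c - 1) +
          ((c : ℝ) + 1) / (2 * c + 3) * adamsCoeff a b (c + 1)) -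
        (b : ℝ) * adamsCoeff a (b - 1) c := by
  have hc1 := two_mul_sub_one_ne_zero c
  rcases Nat.even_or_odd (a + b + c) with he | ho
  · -- every term vanishes by parity
    rw [Nat.even_iff] at he
    have h1 : threeJZeroSq a (b + 1) c = 0 := threeJZeroSq_eq_zero_of_mod_two (by omega)
    have h4 : threeJZeroSq a b (c + 1) = 0 := threeJZeroSq_eq_zero_of_mod_two (by omega)
    have h3 : (c : ℝ) * threeJZeroSq a b (c - 1) = 0 := by
      rcases Nat.eq_zero_or_pos c with rfl | hc
      · simp
      · rw [threeJZeroSq_eq_zero_of_mod_two (by omega), mul_zero]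
    have h2 : (b : ℝ) * threeJZeroSq a (b - 1) c = 0 := by
      rcases Nat.eq_zero_or_pos b with rfl | hb
      · simp
      · rw [threeJZeroSq_eq_zero_of_mod_two (by omega), mul_zero]
    unfold adamsCoeff
    rw [h1, h4]
    linear_combination (-(2 * (b : ℝ) + 1) * (2 * ((c - 1 : ℕ) : ℝ) + 1) / (2 * (c : ℝ) - 1)) * h3 +
      (2 * (c : ℝ) + 1) * h2
  · obtain ⟨s, hs⟩ : ∃ s, a + b + c + 1 = 2 * s := ⟨(a + b + c + 1) / 2, by
      rw [Nat.odd_iff] at ho; omega⟩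
    rcases lt_or_ge s a with ha | ha
    · have h1 : threeJZeroSq a (b + 1) c = 0 := threeJZeroSq_eq_zero_of_lt₂ (by omega)
      have h4 : threeJZeroSq a b (c + 1) = 0 := threeJZeroSq_eq_zero_of_lt₂ (by omega)
      have h3 : threeJZeroSq a b (c - 1) = 0 := threeJZeroSq_eq_zero_of_lt₂ (by omega)
      have h2 : threeJZeroSq a (b - 1) c = 0 := threeJZeroSq_eq_zero_of_lt₂ (by omega)
      unfold adamsCoeff; rw [h1, h2, h3, h4]; ring
    rcases lt_or_ge s b with hb | hb
    · have h1 : threeJZeroSq a (b + 1) c = 0 := threeJZeroSq_eq_zero_of_lt₃ (by omega)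
      have h4 : threeJZeroSq a b (c + 1) = 0 := threeJZeroSq_eq_zero_of_lt₃ (by omega)
      have h3 : threeJZeroSq a b (c - 1) = 0 := threeJZeroSq_eq_zero_of_lt₃ (by omega)
      have h2 : threeJZeroSq a (b - 1) c = 0 := threeJZeroSq_eq_zero_of_lt₃ (by omega)
      unfold adamsCoeff; rw [h1, h2, h3, h4]; ring
    rcases lt_or_ge s c with hc | hc
    · have h1 : threeJZeroSq a (b + 1) c = 0 := threeJZeroSq_eq_zero_of_lt₁ (by omega)
      have h4 : threeJZeroSq a b (c + 1) = 0 := threeJZeroSq_eq_zero_of_lt₁ (by omega)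
      have h3 : threeJZeroSq a b (c - 1) = 0 := threeJZeroSq_eq_zero_of_lt₁ (by omega)
      have h2 : threeJZeroSq a (b - 1) c = 0 := threeJZeroSq_eq_zero_of_lt₁ (by omega)
      unfold adamsCoeff; rw [h1, h2, h3, h4]; ring
    obtain ⟨x, hx⟩ := Nat.exists_eq_add_of_le ha
    obtain ⟨y, hy⟩ := Nat.exists_eq_add_of_le hb
    obtain ⟨z, hz⟩ := Nat.exists_eq_add_of_le hc
    rcases x with _ | p
    · rcases y with _ | q
      · exfalso; omega
      · rcases z with _ | r
        · exfalso; omega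
        · -- x = 0: a = q+r+1, b = r, c = q
          obtain rfl : q + r + 1 = a := by omega
          obtain rfl : r = b := by omega
          obtain rfl : q = c := by omega
          unfold adamsCoeff
          rw [threeJZeroSq_eq_threeJAux (q + r + 1) (r + 1) q 0 q (r + 1) (by omega) (by omega)
              (by omega),
            threeJZeroSq_eq_threeJAux (q + r + 1) r (q + 1) 0 (q + 1) r (by omega) (by omega)
              (by omega),
            threeJZeroSq_eq_zero_of_lt₂ (a := q + r + 1) (b := r) (c := q - 1) (by omega),
            threeJZeroSq_eq_zero_of_lt₂ (a := q + r + 1) (b := r - 1) (c := q) (by omega),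
            threeJAux_succ₃ 0 q r, threeJAux_succ₂ 0 q r]
          have hw := threeJAux_pos 0 q r
          push_cast at hc1 ⊢
          field_simp
          ring
    · rcases y with _ | q
      · rcases z with _ | r
        · exfalso; omega
        · -- y = 0: a = r, b = p+r+1, c = p
          obtain rfl : r = a := by omega
          obtain rfl : p + r + 1 = b := by omega
          obtain rfl : p = c := by omega
          unfold adamsCoeff
          rw [Nat.add_sub_cancel,
            threeJZeroSq_eq_zero_of_lt₃ (a := r) (b := p + r + 1 + 1) (c := p) (by omega),
            threeJZeroSq_eq_threeJAux r (p + r + 1) (p + 1) (p + 1) 0 r (by omega) (by omega)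
              (by omega),
            threeJZeroSq_eq_zero_of_lt₃ (a := r) (b := p + r + 1) (c := p - 1) (by omega),
            threeJZeroSq_eq_threeJAux r (p + r) p p 0 r (by omega) (by omega) (by omega),
            threeJAux_succ₁ p 0 r]
          have hw := threeJAux_pos p 0 r
          push_cast at hc1 ⊢
          field_simp
          ring
      · rcases z with _ | r
        · -- z = 0: a = q, b = p, c = p+q+1
          obtain rfl : q = a := by omega
          obtain rfl : p = b := by omega
          obtain rfl : p + q + 1 = c := by omega
          unfold adamsCoeff
          rw [Nat.add_sub_cancel,
            threeJZeroSq_eq_threeJAux q (p + 1) (p + q + 1) (p + 1) q 0 (by omega) (by omega)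
              (by omega),
            threeJZeroSq_eq_zero_of_lt₁ (a := q) (b := p) (c := p + q + 1 + 1) (by omega),
            threeJZeroSq_eq_threeJAux q p (p + q) p q 0 (by omega) (by omega) (by omega),
            threeJZeroSq_eq_zero_of_lt₁ (a := q) (b := p - 1) (c := p + q + 1) (by omega),
            threeJAux_succ₁ p q 0]
          have hw := threeJAux_pos p q 0
          push_cast at hc1 ⊢
          field_simp
          ring
        · -- generic: a = q+r+1, b = p+r+1, c = p+q+1
          obtain rfl : q + r + 1 = a := by omega
          obtain rfl : p + r + 1 = b := by omega
          obtain rfl : p + q + 1 = c := by omega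
          unfold adamsCoeff
          rw [Nat.add_sub_cancel, Nat.add_sub_cancel,
            threeJZeroSq_eq_threeJAux (q + r + 1) (p + r + 1 + 1) (p + q + 1) (p + 1) q (r + 1)
              (by omega) (by omega) (by omega),
            threeJZeroSq_eq_threeJAux (q + r + 1) (p + r + 1) (p + q) p q (r + 1)
              (by omega) (by omega) (by omega),
            threeJZeroSq_eq_threeJAux (q + r + 1) (p + r + 1) (p + q + 1 + 1) (p + 1) (q + 1) r
              (by omega) (by omega) (by omega),
            threeJZeroSq_eq_threeJAux (q + r + 1) (p + r) (p + q + 1) p (q + 1) r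
              (by omega) (by omega) (by omega),
            threeJAux_succ₁ p q (r + 1), threeJAux_succ₃ p q r, threeJAux_succ₁ p (q + 1) r,
            threeJAux_succ₂ p q r]
          have hw := threeJAux_pos p q r
          push_cast at hc1 ⊢
          field_simp
          ring

/-! ### Adams–Neumann linearisation and the integral of three Legendre polynomials -/

/-- **The Legendre coefficients of `P_a P_b` are the Adams–Neumann coefficients**:
`λ_c(P_a P_b) = (2c+1) (a b c; 0 0 0)²` — by induction on `b` through Bonnet's recursion
(`legendreCoeff_X_mul`, `adamsCoeff_rec`). [cite: DLMF, 34.3.19; Adams1878, pp. 63–71 (the theorem of the note)] -/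
theorem legendreCoeff_legendre_mul_legendre (a b c : ℕ) :
    legendreCoeff (legendre a * legendre b) c = adamsCoeff a b c := by
  induction b using Nat.strong_induction_on generalizing c with
  | _ b ih =>
    rcases b with _ | b
    · rw [legendre_zero, mul_one, legendreCoeff_legendre, adamsCoeff_zero_mid]
    · have hB : C ((b : ℝ) + 1) * (legendre a * legendre (b + 1)) =
          C (2 * (b : ℝ) + 1) * (X * (legendre a * legendre b)) -
            C (b : ℝ) * (legendre a * legendre (b - 1)) := by
        calc C ((b : ℝ) + 1) * (legendre a * legendre (b + 1))
            = legendre a * (C ((b : ℝ) + 1) * legendre (b + 1)) := by ring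
          _ = legendre a * (C (2 * (b : ℝ) + 1) * X * legendre b - C (b : ℝ) * legendre (b - 1)) := by
            rw [legendre_bonnet]
          _ = _ := by ring
      have h2 := congrArg (fun p => legendreCoeff p c) hB
      simp only [legendreCoeff_C_mul, legendreCoeff_sub, legendreCoeff_X_mul] at h2
      rw [ih b (lt_add_one b), ih b (lt_add_one b), ih (b - 1) (by omega)] at h2
      have hb1 : ((b : ℝ) + 1) ≠ 0 := by positivity
      exact mul_left_cancel₀ hb1 (h2.trans (adamsCoeff_rec a b c).symm)

/-- **Adams–Neumann linearisation of a product of Legendre polynomials**: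
`P_a P_b = Σ_{c ≤ a+b} (2c+1) (a b c; 0 0 0)² P_c` (only `|a-b| ≤ c ≤ a+b`, `c ≡ a+b (2)`
contribute) — the program's `legendre_product_in_legendre`.
[cite: DLMF, 34.3.19; Assche2020, (3.7.18); Adams1878, pp. 63–71 (the theorem of the note)] -/
theorem legendre_mul_legendre (a b : ℕ) :
    legendre a * legendre b = ∑ c ∈ range (a + b + 1), C (adamsCoeff a b c) * legendre c := by
  have hdeg : (legendre a * legendre b).natDegree ≤ a + b := by
    refine natDegree_mul_le.trans ?_
    rw [natDegree_legendre, natDegree_legendre]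
  conv_lhs => rw [eq_sum_legendreCoeff hdeg]
  exact sum_congr rfl fun c _ => by rw [legendreCoeff_legendre_mul_legendre]

/-- **The integral of three Legendre polynomials** (Adams–Neumann; Gaunt's integral at `m = 0`):
`∫_{-1}^1 P_a P_b P_c = 2 (a b c; 0 0 0)²` — the program's `gaunt(a, b, c)`.
[cite: DLMF, 34.3.21 (m = 0); BiedenharnLouck1984, (3.193)–(3.194)] -/
theorem integral_legendre_mul_legendre_mul_legendre (a b c : ℕ) :
    ∫ x in (-1 : ℝ)..1, (legendre a).eval x * (legendre b).eval x * (legendre c).eval x =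
      2 * threeJZeroSq a b c := by
  have h := legendreCoeff_legendre_mul_legendre a b c
  unfold legendreCoeff adamsCoeff at h
  simp only [eval_mul] at h
  have hc : (2 * (c : ℝ) + 1) ≠ 0 := by positivity
  apply mul_left_cancel₀ hc
  linear_combination 2 * h

/-- The 3j-symbol squared is symmetric in its first two arguments. [cite: DLMF, 34.3.8–34.3.10] -/
theorem threeJZeroSq_comm₁₂ (a b c : ℕ) : threeJZeroSq a b c = threeJZeroSq b a c := by
  have h1 := integral_legendre_mul_legendre_mul_legendre a b c
  have h2 := integral_legendre_mul_legendre_mul_legendre b a c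
  rw [show (∫ x in (-1 : ℝ)..1, (legendre b).eval x * (legendre a).eval x * (legendre c).eval x) =
      ∫ x in (-1 : ℝ)..1, (legendre a).eval x * (legendre b).eval x * (legendre c).eval x from
    intervalIntegral.integral_congr fun x _ => by ring] at h2
  linarith

/-- The 3j-symbol squared is symmetric in its last two arguments. [cite: DLMF, 34.3.8–34.3.10] -/
theorem threeJZeroSq_comm₂₃ (a b c : ℕ) : threeJZeroSq a b c = threeJZeroSq a c b := by
  have h1 := integral_legendre_mul_legendre_mul_legendre a b c
  have h2 := integral_legendre_mul_legendre_mul_legendre a c b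
  rw [show (∫ x in (-1 : ℝ)..1, (legendre a).eval x * (legendre c).eval x * (legendre b).eval x) =
      ∫ x in (-1 : ℝ)..1, (legendre a).eval x * (legendre b).eval x * (legendre c).eval x from
    intervalIntegral.integral_congr fun x _ => by ring] at h2
  linarith

/-- `h(a,b,c) = h(b,a,c)`. [cite: DLMF, 34.3.8–34.3.9 (squared)] -/
theorem adamsCoeff_comm (a b c : ℕ) : adamsCoeff a b c = adamsCoeff b a c := by
  rw [adamsCoeff, adamsCoeff, threeJZeroSq_comm₁₂]

/-- `h(a,b,c) = 0` unless `|a - b| ≤ c`: the lower triangle bound. [cite: BiedenharnLouck1984, (3.191)] -/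
theorem adamsCoeff_eq_zero_of_lt' {a b c : ℕ} (h : b + c < a ∨ c + a < b) : adamsCoeff a b c = 0 := by
  rcases h with h | h
  · rw [adamsCoeff, threeJZeroSq_eq_zero_of_lt₂ h, mul_zero]
  · rw [adamsCoeff, threeJZeroSq_eq_zero_of_lt₃ h, mul_zero]

/-- `h(a,b,c) = 0` unless `c ≡ a + b (mod 2)`. [cite: BiedenharnLouck1984, (3.195)] -/
theorem adamsCoeff_eq_zero_of_mod_two {a b c : ℕ} (h : (a + b + c) % 2 = 1) : adamsCoeff a b c = 0 := by
  rw [adamsCoeff, threeJZeroSq_eq_zero_of_mod_two h, mul_zero]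

/-- `h(a,b,c) ≥ 0` (the linearisation coefficients of Legendre polynomials are non-negative).
[cite: Assche2020, (3.7.18)] -/
theorem adamsCoeff_nonneg (a b c : ℕ) : 0 ≤ adamsCoeff a b c := by
  unfold adamsCoeff
  have := threeJZeroSq_nonneg a b c
  positivity

/-- **The factorial closed form the program evaluates** (`three_j_zero_sq`): for `J = a+b+c = 2s`
even and `(a,b,c)` a triangle,
`(a b c; 0 0 0)² = (J-2a)! (J-2b)! (J-2c)! / (J+1)! · (s! / ((s-a)! (s-b)! (s-c)!))²`.
[cite: DLMF, 34.3.5; BiedenharnLouck1984, (3.194)] -/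
theorem threeJZeroSq_eq_factorial {a b c : ℕ} (he : Even (a + b + c)) (h₁ : c ≤ a + b)
    (h₂ : a ≤ b + c) (h₃ : b ≤ c + a) :
    threeJZeroSq a b c =
      ((a + b + c - 2 * a)! : ℝ) * (a + b + c - 2 * b)! * (a + b + c - 2 * c)! / (a + b + c + 1)! *
        ((((a + b + c) / 2)! : ℝ) /
          (((a + b + c) / 2 - a)! * ((a + b + c) / 2 - b)! * ((a + b + c) / 2 - c)!)) ^ 2 := by
  obtain ⟨s, hs⟩ := he
  obtain ⟨x, y, z, rfl, rfl, rfl⟩ : ∃ x y z, a = y + z ∧ b = x + z ∧ c = x + y :=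
    ⟨s - a, s - b, s - c, by omega, by omega, by omega⟩
  rw [threeJZeroSq_eq_threeJAux _ _ _ x y z rfl rfl rfl,
    show y + z + (x + z) + (x + y) - 2 * (y + z) = 2 * x by omega,
    show y + z + (x + z) + (x + y) - 2 * (x + z) = 2 * y by omega,
    show y + z + (x + z) + (x + y) - 2 * (x + y) = 2 * z by omega,
    show (y + z + (x + z) + (x + y)) / 2 = x + y + z by omega,
    show x + y + z - (y + z) = x by omega, show x + y + z - (x + z) = y by omega,
    show x + y + z - (x + y) = z by omega,
    show y + z + (x + z) + (x + y) + 1 = 2 * (x + y + z) + 1 by omega]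
  unfold threeJAux
  have hcb : ∀ n : ℕ, (n.centralBinom : ℝ) = (2 * n)! / ((n ! : ℝ) * n !) := by
    intro n
    rw [eq_div_iff (by positivity)]
    have h := Nat.choose_mul_factorial_mul_factorial (show n ≤ 2 * n by omega)
    rw [show 2 * n - n = n by omega, ← Nat.centralBinom_eq_two_mul_choose] at h
    rw [← mul_assoc]
    exact_mod_cast h
  rw [hcb, hcb, hcb, hcb, Nat.factorial_succ (2 * (x + y + z))]
  push_cast
  field_simp

/-! ### Selection rules for `∫ P_l P_{l'} Q` -/

/-- `∫_{-1}^1 P_a P_b Q = (2/(2b+1)) λ_b(Q P_a)` — the program's `triple_TP` read-out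
`T^P_L[l,l'] = (2/(2l'+1)) [T_{2L}(J) e_l]_{l'}` (with `Q = T_{2L}`). [cite: Arfken1985, (12.50)] -/
theorem integral_legendre_mul_legendre_mul (a b : ℕ) (Q : ℝ[X]) :
    ∫ x in (-1 : ℝ)..1, (legendre a).eval x * (legendre b).eval x * Q.eval x =
      2 / (2 * b + 1) * legendreCoeff (Q * legendre a) b := by
  rw [← integral_mul_legendre_eq_legendreCoeff]
  exact intervalIntegral.integral_congr fun x _ => by simp only [eval_mul]; ring

/-- **Selection rule**: `∫_{-1}^1 P_a P_b Q = 0` when `deg Q + a < b`. [cite: AndrewsAskeyRoy1999, (2.5.14)] -/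
theorem integral_legendre_mul_legendre_mul_eq_zero_of_lt {a b : ℕ} {Q : ℝ[X]}
    (h : Q.natDegree + a < b) :
    ∫ x in (-1 : ℝ)..1, (legendre a).eval x * (legendre b).eval x * Q.eval x = 0 := by
  rw [integral_legendre_mul_legendre_mul, legendreCoeff_eq_zero_of_natDegree_lt, mul_zero]
  refine natDegree_mul_le.trans_lt ?_
  rw [natDegree_legendre]
  exact h

/-- **Parity rule**: for an even polynomial `Q`, `∫_{-1}^1 P_a P_b Q = 0` when `a + b` is odd
(`P_n(-x) = (-1)ⁿ P_n(x)`). [cite: Arfken1985, (12.37)] -/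
theorem integral_legendre_mul_legendre_mul_eq_zero_of_odd {a b : ℕ} {Q : ℝ[X]}
    (hQ : ∀ x, Q.eval (-x) = Q.eval x) (h : Odd (a + b)) :
    ∫ x in (-1 : ℝ)..1, (legendre a).eval x * (legendre b).eval x * Q.eval x = 0 := by
  have h1 := intervalIntegral.integral_comp_neg (a := (-1 : ℝ)) (b := 1)
    (fun x : ℝ => (legendre a).eval x * (legendre b).eval x * Q.eval x)
  simp only [neg_neg] at h1
  have h2 : ∀ x : ℝ, (legendre a).eval (-x) * (legendre b).eval (-x) * Q.eval (-x) =
      -((legendre a).eval x * (legendre b).eval x * Q.eval x) := by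
    intro x
    rw [eval_neg_legendre, eval_neg_legendre, hQ,
      show (-1 : ℝ) ^ a * (legendre a).eval x * ((-1) ^ b * (legendre b).eval x) * Q.eval x =
        (-1) ^ (a + b) * ((legendre a).eval x * (legendre b).eval x * Q.eval x) by ring, h.neg_one_pow]
    ring
  simp_rw [h2, intervalIntegral.integral_neg] at h1
  linarith

/-- The Chebyshev polynomial `T_{2L}` is even. [cite: DLMF, Table 18.6.1 (`T_n(-x) = (-1)ⁿ T_n(x)`)] (Mathlib's `Chebyshev.T_eval_neg`) -/
theorem eval_neg_chebyshev_T_two_mul (L : ℕ) (x : ℝ) :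
    (Chebyshev.T ℝ (2 * L)).eval (-x) = (Chebyshev.T ℝ (2 * L)).eval x := by
  rw [Chebyshev.T_eval_neg, Int.negOnePow_two_mul]
  simp

/-- **The structural identities of the table `T^P_L[l,l'] = ∫ P_l P_{l'} T_{2L}`** checked by the
program's `crosscheck_tables`: symmetry, the selection rule `|l - l'| ≤ 2L`, the parity rule
`l + l'` even, and the `L = 0` values `2/(2l+1) δ_{ll'}`. [cite: AndrewsAskeyRoy1999, (2.5.14); Arfken1985, (12.37); DLMF, Table 18.6.1] -/
theorem integral_legendre_mul_legendre_mul_chebyshev_T (L l l' : ℕ) :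
    (∫ x in (-1 : ℝ)..1, (legendre l).eval x * (legendre l').eval x * (Chebyshev.T ℝ (2 * L)).eval x =
      ∫ x in (-1 : ℝ)..1, (legendre l').eval x * (legendre l).eval x * (Chebyshev.T ℝ (2 * L)).eval x) ∧
    (l + 2 * L < l' →
      ∫ x in (-1 : ℝ)..1, (legendre l).eval x * (legendre l').eval x * (Chebyshev.T ℝ (2 * L)).eval x = 0) ∧
    (Odd (l + l') →
      ∫ x in (-1 : ℝ)..1, (legendre l).eval x * (legendre l').eval x * (Chebyshev.T ℝ (2 * L)).eval x = 0) ∧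
    (∫ x in (-1 : ℝ)..1, (legendre l).eval x * (legendre l').eval x * (Chebyshev.T ℝ (2 * 0)).eval x =
      if l = l' then (2 : ℝ) / (2 * l + 1) else 0) := by
  refine ⟨intervalIntegral.integral_congr fun x _ => by ring, fun h => ?_, fun h => ?_, ?_⟩
  · apply integral_legendre_mul_legendre_mul_eq_zero_of_lt
    have : (Chebyshev.T ℝ (2 * L)).natDegree = 2 * L := by
      rw [Chebyshev.natDegree_T]; omega
    omega
  · exact integral_legendre_mul_legendre_mul_eq_zero_of_odd (eval_neg_chebyshev_T_two_mul L) h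
  · simp only [mul_zero, Chebyshev.T_zero, eval_one, mul_one]
    exact integral_legendre_mul_legendre l l'

/-! ### Monomials in the Legendre basis and the monomial coefficients of `P_n` -/

/-- `λ_j(x^{j+2h}) = (2j+1) (j+2h)! / (2ʰ h! (2j+2h+1)!!)` (the even moments of `P_j`).
[cite: Arfken1985, Ex. 12.4.4–12.4.6 (p. 665); DLMF, 18.18.17 (λ = ½)] -/
theorem legendreCoeff_X_pow_add_two_mul (j h : ℕ) :
    legendreCoeff (X ^ (j + 2 * h)) j =
      (2 * j + 1) * ((j + 2 * h)! : ℝ) / (2 ^ h * h ! * ((2 * j + 2 * h + 1)‼ : ℕ)) := by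
  have hμ := legendreMoment_add_two_mul j h
  have hI : (∫ x in (-1 : ℝ)..1, (X ^ (j + 2 * h) : ℝ[X]).eval x * (legendre j).eval x) =
      legendreMoment (j + 2 * h) j := by
    unfold legendreMoment
    simp only [eval_pow, eval_X]
  unfold legendreCoeff
  rw [hI]
  have hpos : (0 : ℝ) < 2 ^ h * h ! * ((2 * j + 2 * h + 1)‼ : ℕ) := by
    have := Nat.doubleFactorial_pos (2 * j + 2 * h + 1)
    positivity
  rw [eq_div_iff hpos.ne']
  linear_combination (2 * (j : ℝ) + 1) / 2 * hμ

/-- `λ_j(x^k) = 0` for `k < j`. [cite: Arfken1985, Ex. 12.4.3 (p. 665); AndrewsAskeyRoy1999, (2.5.14)] -/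
theorem legendreCoeff_X_pow_eq_zero_of_lt {k j : ℕ} (h : k < j) : legendreCoeff (X ^ k) j = 0 :=
  legendreCoeff_eq_zero_of_natDegree_lt (by rwa [natDegree_X_pow])

/-- `λ_j(x^k) = 0` for `k + j` odd (parity). [cite: Arfken1985, (12.37)] -/
theorem legendreCoeff_X_pow_eq_zero_of_odd {k j : ℕ} (h : Odd (k + j)) : legendreCoeff (X ^ k) j = 0 := by
  have h0 := legendreMoment_eq_zero_of_odd h
  unfold legendreMoment at h0
  unfold legendreCoeff
  simp only [eval_pow, eval_X]
  rw [h0, mul_zero]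

/-- **The Legendre coefficients of a monomial** — the program's `monomial_in_legendre(k)`:
`x^k = Σ_j a_{k,j} P_j` with `a_{k,j} = (2j+1) k! / (2^{(k-j)/2} ((k-j)/2)! (k+j+1)!!)` for
`j ≤ k`, `j ≡ k (mod 2)`, and `0` otherwise. [cite: Arfken1985, Ex. 12.4.6 (p. 665); DLMF, 18.18.17 (λ = ½)] -/
noncomputable def monomialLegendreCoeff (k j : ℕ) : ℝ :=
  if j ≤ k ∧ Even (k + j) then
    (2 * j + 1) * (k ! : ℝ) / (2 ^ ((k - j) / 2) * ((k - j) / 2)! * ((k + j + 1)‼ : ℕ))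
  else 0

/-- `λ_j(x^k) = a_{k,j}`. [cite: Arfken1985, Ex. 12.4.6 (p. 665); DLMF, 18.18.17 (λ = ½)] -/
theorem legendreCoeff_X_pow (k j : ℕ) : legendreCoeff (X ^ k) j = monomialLegendreCoeff k j := by
  unfold monomialLegendreCoeff
  split_ifs with h
  · obtain ⟨hjk, he⟩ := h
    obtain ⟨m, hm⟩ : ∃ m, k = j + 2 * m := ⟨(k - j) / 2, by rw [Nat.even_iff] at he; omega⟩
    subst hm
    rw [legendreCoeff_X_pow_add_two_mul, show j + 2 * m - j = 2 * m by omega,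
      show 2 * m / 2 = m by omega, show j + 2 * m + j + 1 = 2 * j + 2 * m + 1 by ring]
  · rw [not_and_or, not_le] at h
    rcases h with h | h
    · exact legendreCoeff_X_pow_eq_zero_of_lt h
    · exact legendreCoeff_X_pow_eq_zero_of_odd (Nat.not_even_iff_odd.mp h)

/-- **A monomial in the Legendre basis**: `x^k = Σ_{j ≤ k} a_{k,j} P_j`.
[cite: Arfken1985, Ex. 12.4.6 (p. 665); DLMF, 18.18.17 (λ = ½)] -/
theorem X_pow_eq_sum_legendre (k : ℕ) :
    (X : ℝ[X]) ^ k = ∑ j ∈ range (k + 1), C (monomialLegendreCoeff k j) * legendre j := by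
  conv_lhs => rw [eq_sum_legendreCoeff (natDegree_X_pow_le (R := ℝ) k)]
  exact sum_congr rfl fun j _ => by rw [legendreCoeff_X_pow]

/-- The Legendre coefficients of any polynomial from its monomial coefficients (the program's
`chebyshev_in_legendre`: `g_j = Σ_k c_k a_{k,j}`). [cite: Arfken1985, (12.50) with Ex. 12.4.6 (p. 665)] -/
theorem legendreCoeff_eq_sum_coeff_mul (Q : ℝ[X]) (j : ℕ) :
    legendreCoeff Q j = ∑ k ∈ range (Q.natDegree + 1), Q.coeff k * monomialLegendreCoeff k j := by
  conv_lhs => rw [Q.as_sum_range_C_mul_X_pow]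
  rw [legendreCoeff_sum]
  exact sum_congr rfl fun k _ => by rw [legendreCoeff_C_mul, legendreCoeff_X_pow]

/-- **The monomial coefficients of `P_n`** (Rodrigues' formula expanded; the terms with `2k > n`
vanish) — the program's `legendre_monomial_coeffs(n)`:
`P_n(x) = 2⁻ⁿ Σ_k (-1)^k C(n,k) C(2n-2k, n) x^{n-2k}`.
[cite: Arfken1985, (12.8) and (12.64)–(12.64a); AbramowitzStegun1964, 22.3.8] -/
theorem legendre_eq_sum_monomial (n : ℕ) :
    legendre n = ∑ k ∈ range (n + 1),
      C ((-1 : ℝ) ^ k * n.choose k * ((2 * n - 2 * k).choose n) / 2 ^ n) * X ^ (n - 2 * k) := by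
  have hW : legendreW n =
      ∑ k ∈ range (n + 1), C ((-1 : ℝ) ^ k * n.choose k) * X ^ (2 * n - 2 * k) := by
    unfold legendreW
    rw [sub_eq_neg_add, add_pow]
    refine sum_congr rfl fun k hk => ?_
    have hk' : k ≤ n := Nat.lt_succ_iff.mp (mem_range.mp hk)
    rw [← pow_mul, show 2 * (n - k) = 2 * n - 2 * k by omega, map_mul, map_pow, map_neg, map_one,
      map_natCast]
    ring
  unfold legendre
  rw [hW, iterate_derivative_sum, mul_sum]
  refine sum_congr rfl fun k _ => ?_
  rw [iterate_derivative_C_mul, iterate_derivative_X_pow_eq_C_mul,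
    show 2 * n - 2 * k - n = n - 2 * k by omega, Nat.descFactorial_eq_factorial_mul_choose,
    ← mul_assoc, ← mul_assoc, ← C_mul, ← C_mul]
  congr 2
  push_cast
  field_simp

/-- The same with the sum stopped at `k ≤ n/2` (as the program loops). [cite: Arfken1985, (12.8)] -/
theorem legendre_eq_sum_monomial' (n : ℕ) :
    legendre n = ∑ k ∈ range (n / 2 + 1),
      C ((-1 : ℝ) ^ k * n.choose k * ((2 * n - 2 * k).choose n) / 2 ^ n) * X ^ (n - 2 * k) := by
  rw [legendre_eq_sum_monomial, ← sum_range_add_sum_Ico _ (show n / 2 + 1 ≤ n + 1 by omega)]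
  conv_rhs => rw [← add_zero (∑ k ∈ range (n / 2 + 1), _)]
  congr 1
  refine sum_eq_zero fun k hk => ?_
  rw [mem_Ico] at hk
  rw [Nat.choose_eq_zero_of_lt (show 2 * n - 2 * k < n by omega)]
  simp

/-! ### The two derivative identities of the `T^S` table -/

/-- **`(1 - x²) P'_l = (l(l+1)/(2l+1)) (P_{l-1} - P_{l+1})`** (for `l = 0` both sides vanish).
[cite: Assche2020, (3.7.9); Arfken1985, (12.26) with (12.17)] -/
theorem one_sub_X_sq_mul_derivative_legendre (l : ℕ) :
    (1 - X ^ 2) * derivative (legendre l) =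
      C ((l : ℝ) * (l + 1) / (2 * l + 1)) * (legendre (l - 1) - legendre (l + 1)) := by
  rcases l with _ | n
  · simp [legendre_zero]
  · apply Polynomial.funext
    intro x
    have e1 := congrArg (fun p => p.eval x) (X_sq_sub_one_mul_derivative_legendre n)
    have e2 := congrArg (fun p => p.eval x) (X_mul_legendre (n + 1))
    simp only [eval_mul, eval_sub, eval_add, eval_pow, eval_X, eval_C, eval_one, eval_natCast,
      Nat.add_sub_cancel] at e1 e2 ⊢
    push_cast at e1 e2 ⊢
    have h3 : (2 * ((n : ℝ) + 1) + 1) ≠ 0 := by positivity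
    have e2' : x * (legendre (n + 1)).eval x * (2 * ((n : ℝ) + 1) + 1) =
        ((n : ℝ) + 1 + 1) * (legendre (n + 1 + 1)).eval x + ((n : ℝ) + 1) * (legendre n).eval x := by
      rw [e2]
      field_simp
    have key : (1 - x ^ 2) * (derivative (legendre (n + 1))).eval x * (2 * ((n : ℝ) + 1) + 1) =
        ((n : ℝ) + 1) * ((n : ℝ) + 1 + 1) * ((legendre n).eval x - (legendre (n + 1 + 1)).eval x) := by
      linear_combination (-(2 * ((n : ℝ) + 1) + 1)) * e1 - ((n : ℝ) + 1) * e2'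
    rw [div_mul_eq_mul_div, eq_div_iff h3]
    exact key

/-- **`P'_n = Σ_{j < n, j ≡ n-1 (2)} (2j+1) P_j`** (telescoping `P'_{j+1} - P'_{j-1} = (2j+1) P_j`).
[cite: Arfken1985, (12.23) (telescoped)] -/
theorem derivative_legendre_eq_sum (n : ℕ) :
    derivative (legendre n) =
      ∑ j ∈ range n, C (if (j + n) % 2 = 1 then 2 * (j : ℝ) + 1 else 0) * legendre j := by
  induction n using Nat.strong_induction_on with
  | _ n ih =>
    rcases n with _ | _ | m
    · simp [legendre_zero]
    · simp [legendre_one, legendre_zero]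
    · have h := derivative_legendre_add_two_sub m
      rw [sub_eq_iff_eq_add] at h
      rw [h, ih m (by omega), sum_range_succ, sum_range_succ]
      have e1 : ∀ j, (j + (m + 2)) % 2 = (j + m) % 2 := fun j => by omega
      simp_rw [e1]
      rw [if_neg (by omega), if_pos (by omega)]
      simp only [map_zero, zero_mul, add_zero]
      rw [add_comm]
      congr 1
      simp only [map_add, map_mul, map_natCast, map_ofNat, map_one]
      push_cast
      ring

/-- The same sum written over the filtered index set. [cite: Arfken1985, (12.23)] -/
theorem derivative_legendre_eq_sum_filter (n : ℕ) :
    derivative (legendre n) =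
      ∑ j ∈ (range n).filter (fun j => (j + n) % 2 = 1), C (2 * (j : ℝ) + 1) * legendre j := by
  rw [derivative_legendre_eq_sum, sum_filter]
  exact sum_congr rfl fun j _ => by split_ifs <;> simp

/-- The Legendre coefficients of `P'_n`: `λ_j(P'_n) = 2j+1` for `j < n`, `j ≡ n - 1 (mod 2)`, else `0`.
[cite: Arfken1985, (12.23)] -/
theorem legendreCoeff_derivative_legendre (n j : ℕ) :
    legendreCoeff (derivative (legendre n)) j = if j < n ∧ (j + n) % 2 = 1 then 2 * (j : ℝ) + 1 else 0 := by
  rw [derivative_legendre_eq_sum, legendreCoeff_sum_C_mul_legendre]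
  by_cases h1 : j < n <;> by_cases h2 : (j + n) % 2 = 1 <;> simp [h1, h2]

/-! ### The two methods of the program for `T^P_L[l,l']` and `T^S_L[l,l']` -/

/-- **Method R, the Chebyshev step on Legendre coefficient vectors** (`chebyshev_T_apply`:
`T_{m+2}(J) v = 2 J T_{m+1}(J) v - T_m(J) v`, `J` = multiplication by `x` = `mul_mu`):
`λ_c(T_{m+2} R) = 2 λ_c(x · T_{m+1} R) - λ_c(T_m R)`. [cite: DLMF, 18.9.1 with 18.9.2 (Chebyshev case)]
(Mathlib's `Polynomial.Chebyshev.T_add_two`) -/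
theorem legendreCoeff_chebyshev_T_add_two_mul (m : ℕ) (R : ℝ[X]) (c : ℕ) :
    legendreCoeff (Chebyshev.T ℝ (m + 2) * R) c =
      2 * legendreCoeff (X * (Chebyshev.T ℝ (m + 1) * R)) c - legendreCoeff (Chebyshev.T ℝ m * R) c := by
  have h : Chebyshev.T ℝ (m + 2) * R =
      C (2 : ℝ) * (X * (Chebyshev.T ℝ (m + 1) * R)) - Chebyshev.T ℝ m * R := by
    have hT := Chebyshev.T_add_two (R := ℝ) (m : ℤ)
    have h2 : (C (2 : ℝ) : ℝ[X]) = 2 := map_ofNat C 2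
    rw [hT, h2]
    ring
  rw [h, legendreCoeff_sub, legendreCoeff_C_mul]

/-- **Method G for `T^P`**: expanding `Q = Σ_j λ_j(Q) P_j` (`deg Q ≤ m`),
`∫_{-1}^1 P_a P_b Q = Σ_{j ≤ m} λ_j(Q) · 2 (a b j; 0 0 0)²` — the program's `triple_TP_gaunt`
(`Q = T_{2L}`, `λ_j(Q) = g_j` from `chebyshev_in_legendre`). [cite: DLMF, 34.3.21 (m = 0)] -/
theorem integral_legendre_mul_legendre_mul_eq_sum_threeJZeroSq (a b : ℕ) {Q : ℝ[X]} {m : ℕ}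
    (hQ : Q.natDegree ≤ m) :
    ∫ x in (-1 : ℝ)..1, (legendre a).eval x * (legendre b).eval x * Q.eval x =
      ∑ j ∈ range (m + 1), legendreCoeff Q j * (2 * threeJZeroSq a b j) := by
  have hx : ∀ x : ℝ, (legendre a).eval x * (legendre b).eval x * Q.eval x =
      ∑ j ∈ range (m + 1), legendreCoeff Q j *
        ((legendre a).eval x * (legendre b).eval x * (legendre j).eval x) := by
    intro x
    conv_lhs => rw [eq_sum_legendreCoeff hQ]
    rw [eval_finsetSum, mul_sum]
    exact sum_congr rfl fun j _ => by simp only [eval_mul, eval_C]; ring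
  simp_rw [hx]
  rw [intervalIntegral.integral_finsetSum]
  · refine sum_congr rfl fun j _ => ?_
    rw [intervalIntegral.integral_const_mul, integral_legendre_mul_legendre_mul_legendre]
  · intro j _
    apply Continuous.intervalIntegrable
    fun_prop

/-- **The `T^S` table reduced to Legendre coefficient vectors** (both methods of the program):
`∫_{-1}^1 (1-x²) P'_l P'_{l'} Q = (2l(l+1)/(2l+1)) Σ_{j<l', j≡l'-1 (2)} [λ_j(Q P_{l-1}) - λ_j(Q P_{l+1})]`
(from `one_sub_X_sq_mul_derivative_legendre` and `derivative_legendre_eq_sum_filter`; for `l = 0`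
or `l' = 0` both sides vanish) — `triple_TS` with `Q = T_{2L}`; with
`integral_legendre_mul_legendre_mul_eq_sum_threeJZeroSq` it is `triple_TS_gaunt`.
[cite: Assche2020, (3.7.9); Arfken1985, (12.23)] -/
theorem integral_one_sub_sq_mul_derivative_legendre_mul (l l' : ℕ) (Q : ℝ[X]) :
    ∫ x in (-1 : ℝ)..1, (1 - x ^ 2) * (derivative (legendre l)).eval x *
        (derivative (legendre l')).eval x * Q.eval x =
      2 * l * (l + 1) / (2 * l + 1) *
        ∑ j ∈ (range l').filter (fun j => (j + l') % 2 = 1),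
          (legendreCoeff (Q * legendre (l - 1)) j - legendreCoeff (Q * legendre (l + 1)) j) := by
  set S := (range l').filter (fun j => (j + l') % 2 = 1) with hS
  have hx : ∀ x : ℝ, (1 - x ^ 2) * (derivative (legendre l)).eval x *
      (derivative (legendre l')).eval x * Q.eval x =
      ∑ j ∈ S, ((l : ℝ) * (l + 1) / (2 * l + 1) * (2 * j + 1)) *
        ((legendre (l - 1)).eval x * (legendre j).eval x * Q.eval x -
          (legendre (l + 1)).eval x * (legendre j).eval x * Q.eval x) := by
    intro x
    have e1 := congrArg (fun p => p.eval x) (one_sub_X_sq_mul_derivative_legendre l)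
    have e2 := congrArg (fun p => p.eval x) (derivative_legendre_eq_sum_filter l')
    simp only [eval_mul, eval_sub, eval_pow, eval_X, eval_C, eval_one, eval_finsetSum] at e1 e2
    rw [e1, e2, mul_sum, sum_mul]
    exact sum_congr rfl fun j _ => by ring
  simp_rw [hx]
  rw [intervalIntegral.integral_finsetSum]
  · rw [mul_sum]
    refine sum_congr rfl fun j _ => ?_
    rw [intervalIntegral.integral_const_mul,
      intervalIntegral.integral_sub (by apply Continuous.intervalIntegrable; fun_prop)
        (by apply Continuous.intervalIntegrable; fun_prop),
      integral_legendre_mul_legendre_mul, integral_legendre_mul_legendre_mul]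
    have h1 : (2 * (j : ℝ) + 1) ≠ 0 := by positivity
    have h2 : (2 * (l : ℝ) + 1) ≠ 0 := by positivity
    field_simp
  · intro j _
    apply Continuous.intervalIntegrable
    fun_prop

/-- **Legendre's differential equation** in self-adjoint form: `((1 - x²) P_l')' = -l(l+1) P_l`.
[cite: Arfken1985, (12.28); Assche2020, (3.7.9)] -/
theorem derivative_one_sub_X_sq_mul_derivative_legendre (l : ℕ) :
    derivative ((1 - X ^ 2) * derivative (legendre l)) = -(C ((l : ℝ) * (l + 1)) * legendre l) := by
  rcases l with _ | n
  · simp [legendre_zero]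
  · rw [one_sub_X_sq_mul_derivative_legendre, derivative_C_mul, Nat.add_sub_cancel, derivative_sub,
      show derivative (legendre n) - derivative (legendre (n + 1 + 1)) =
        -((2 * (n : ℝ[X]) + 3) * legendre (n + 1)) by rw [← derivative_legendre_add_two_sub]; ring]
    apply Polynomial.funext
    intro x
    simp only [eval_mul, eval_neg, eval_C, eval_add, eval_natCast, eval_ofNat]
    push_cast
    have h3 : (2 * ((n : ℝ) + 1) + 1) ≠ 0 := by positivity
    field_simp
    ring

/-- The `L = 0` value of the `T^S` table: `∫_{-1}^1 (1-x²) P'_l P'_{l'} = (2l(l+1)/(2l+1)) δ_{ll'}`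
(integration by parts against Legendre's equation, then orthogonality).
[cite: Arfken1985, (12.28); AndrewsAskeyRoy1999, Cor. 2.5.3 (remark)] -/
theorem integral_one_sub_sq_mul_derivative_legendre_mul_derivative_legendre (l l' : ℕ) :
    ∫ x in (-1 : ℝ)..1, (1 - x ^ 2) * (derivative (legendre l)).eval x *
        (derivative (legendre l')).eval x =
      if l = l' then 2 * (l : ℝ) * (l + 1) / (2 * l + 1) else 0 := by
  have h := integral_derivative_mul ((1 - X ^ 2) * derivative (legendre l)) (legendre l')
  have hA : (∫ x in (-1 : ℝ)..1, (derivative ((1 - X ^ 2) * derivative (legendre l))).eval x *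
      (legendre l').eval x) = -((l : ℝ) * (l + 1)) *
        ∫ x in (-1 : ℝ)..1, (legendre l).eval x * (legendre l').eval x := by
    rw [derivative_one_sub_X_sq_mul_derivative_legendre, ← intervalIntegral.integral_const_mul]
    exact intervalIntegral.integral_congr fun x _ => by simp only [eval_neg, eval_mul, eval_C]; ring
  have hB : (∫ x in (-1 : ℝ)..1, ((1 - X ^ 2) * derivative (legendre l) : ℝ[X]).eval x *
      (derivative (legendre l')).eval x) = ∫ x in (-1 : ℝ)..1, (1 - x ^ 2) *
        (derivative (legendre l)).eval x * (derivative (legendre l')).eval x :=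
    intervalIntegral.integral_congr fun x _ => by simp [eval_mul, eval_sub, eval_pow, eval_X, eval_one]
  have hb1 : ((1 - X ^ 2) * derivative (legendre l) : ℝ[X]).eval 1 = 0 := by simp
  have hb2 : ((1 - X ^ 2) * derivative (legendre l) : ℝ[X]).eval (-1) = 0 := by simp
  rw [hb1, hb2, hA, hB] at h
  have key : (∫ x in (-1 : ℝ)..1, (1 - x ^ 2) * (derivative (legendre l)).eval x *
      (derivative (legendre l')).eval x) =
      ((l : ℝ) * (l + 1)) * ∫ x in (-1 : ℝ)..1, (legendre l).eval x * (legendre l').eval x := by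
    linarith
  rw [key, integral_legendre_mul_legendre]
  split_ifs <;> ring

/-! ### The monomial coefficients of the Chebyshev polynomial `T_m` -/

/-- The program's `chebyshev_monomial_coeffs(m)`: the coefficient of `x^{m-2k}` in `T_m(x)`
(`m ≥ 1`, `k ≤ m/2`) is `(-1)^k m (m-k-1)! 2^{m-2k} / (2 k! (m-2k)!)`.
[cite: AbramowitzStegun1964, 22.3.6] -/
noncomputable def chebyshevMonomialCoeff (m k : ℕ) : ℝ :=
  (-1) ^ k * m * ((m - k - 1)! : ℝ) * 2 ^ (m - 2 * k) / (2 * k ! * (m - 2 * k)!)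

/-- The coefficients of `T_1 = x` in the closed form. [folklore] -/
private theorem coeff_T_one (e : ℕ) : (Chebyshev.T ℝ 1).coeff e =
    if e ≤ 1 ∧ Even (1 + e) then chebyshevMonomialCoeff 1 ((1 - e) / 2) else 0 := by
  rw [Chebyshev.T_one]
  rcases e with _ | _ | e
  · simp
  · norm_num [chebyshevMonomialCoeff, coeff_X]
  · rw [coeff_X, if_neg (by omega), if_neg (fun h => absurd h.1 (by omega))]

/-- The coefficients of `T_2 = 2x² - 1` in the closed form. [folklore] -/
private theorem coeff_T_two (e : ℕ) : (Chebyshev.T ℝ 2).coeff e =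
    if e ≤ 2 ∧ Even (2 + e) then chebyshevMonomialCoeff 2 ((2 - e) / 2) else 0 := by
  rw [Chebyshev.T_two, show (2 * X ^ 2 - 1 : ℝ[X]) = C 2 * X ^ 2 - C 1 by simp [map_ofNat], coeff_sub,
    coeff_C_mul, coeff_X_pow, coeff_C]
  rcases e with _ | _ | _ | e
  · norm_num [chebyshevMonomialCoeff]
  · norm_num
  · norm_num [chebyshevMonomialCoeff, Nat.factorial]
  · rw [if_neg (by omega), if_neg (by omega), if_neg (fun h => absurd h.1 (by omega))]
    ring

/-- **The monomial coefficients of `T_m`** (`m ≥ 1`): the coefficient of `x^e` is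
`chebyshevMonomialCoeff m ((m-e)/2)` for `e ≤ m`, `e ≡ m (mod 2)`, and `0` otherwise — by induction on
`T_{m+2} = 2x T_{m+1} - T_m`. [cite: AbramowitzStegun1964, 22.3.6] -/
theorem coeff_chebyshev_T : ∀ {m : ℕ}, 1 ≤ m → ∀ e : ℕ,
    (Chebyshev.T ℝ m).coeff e =
      if e ≤ m ∧ Even (m + e) then chebyshevMonomialCoeff m ((m - e) / 2) else 0
  | 0, h, _ => absurd h (by norm_num)
  | 1, _, e => by simpa using coeff_T_one e
  | 2, _, e => by simpa using coeff_T_two e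
  | n + 3, _, e => by
    have ih1 := fun e => coeff_chebyshev_T (m := n + 1) (by omega) e
    have ih2 := fun e => coeff_chebyshev_T (m := n + 2) (by omega) e
    have hT : Chebyshev.T ℝ ((n + 3 : ℕ) : ℤ) =
        C (2 : ℝ) * (X * Chebyshev.T ℝ ((n + 2 : ℕ) : ℤ)) - Chebyshev.T ℝ ((n + 1 : ℕ) : ℤ) := by
      have h := Chebyshev.T_add_two (R := ℝ) ((n : ℤ) + 1)
      have h2 : (C (2 : ℝ) : ℝ[X]) = 2 := map_ofNat C 2
      push_cast
      rw [show (n : ℤ) + 3 = (n : ℤ) + 1 + 2 by ring, h, show (n : ℤ) + 1 + 1 = (n : ℤ) + 2 by ring, h2]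
      ring
    rw [hT, coeff_sub, coeff_C_mul]
    rcases e with _ | e
    · rw [mul_coeff_zero, coeff_X_zero, zero_mul, mul_zero, zero_sub, ih1 0]
      by_cases hp : Even (n + 1)
      · obtain ⟨i, rfl⟩ : ∃ i, n = 2 * i + 1 := by
          obtain ⟨r, hr⟩ := hp
          exact ⟨r - 1, by omega⟩
        rw [if_pos ⟨by omega, ⟨i + 1, by omega⟩⟩, if_pos ⟨by omega, ⟨i + 2, by omega⟩⟩,
          show (2 * i + 1 + 1 - 0) / 2 = i + 1 by omega,
          show (2 * i + 1 + 3 - 0) / 2 = i + 2 by omega]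
        unfold chebyshevMonomialCoeff
        rw [show 2 * i + 1 + 1 - (i + 1) - 1 = i by omega,
          show 2 * i + 1 + 1 - 2 * (i + 1) = 0 by omega,
          show 2 * i + 1 + 3 - (i + 2) - 1 = i + 1 by omega,
          show 2 * i + 1 + 3 - 2 * (i + 2) = 0 by omega,
          Nat.factorial_succ (i + 1), Nat.factorial_succ i]
        push_cast
        field_simp
        ring
      · rw [if_neg (fun h => hp (by simpa using h.2)),
          if_neg (fun h => hp (by have := h.2; rw [Nat.even_iff] at this ⊢; omega))]
        ring
    · rw [coeff_X_mul, ih2 e, ih1 (e + 1)]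
      by_cases hp : Even (n + e)
      · by_cases he : e ≤ n
        · obtain ⟨j, rfl⟩ : ∃ j, n = e + 2 * j := by
            rw [Nat.even_iff] at hp
            exact ⟨(n - e) / 2, by omega⟩
          rw [if_pos ⟨by omega, ⟨e + j + 1, by omega⟩⟩, if_pos ⟨by omega, ⟨e + j + 1, by omega⟩⟩,
            if_pos ⟨by omega, ⟨e + j + 2, by omega⟩⟩,
            show (e + 2 * j + 2 - e) / 2 = j + 1 by omega,
            show (e + 2 * j + 1 - (e + 1)) / 2 = j by omega,
            show (e + 2 * j + 3 - (e + 1)) / 2 = j + 1 by omega]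
          unfold chebyshevMonomialCoeff
          rw [show e + 2 * j + 2 - (j + 1) - 1 = e + j by omega,
            show e + 2 * j + 2 - 2 * (j + 1) = e by omega,
            show e + 2 * j + 1 - j - 1 = e + j by omega,
            show e + 2 * j + 1 - 2 * j = e + 1 by omega,
            show e + 2 * j + 3 - (j + 1) - 1 = e + j + 1 by omega,
            show e + 2 * j + 3 - 2 * (j + 1) = e + 1 by omega,
            Nat.factorial_succ (e + j), Nat.factorial_succ j, Nat.factorial_succ e]
          push_cast
          field_simp
          ring
        · have hne : e ≠ n + 1 := by
            rintro rfl
            rw [Nat.even_iff] at hp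
            omega
          rcases Nat.lt_or_ge (n + 2) e with h | h
          · rw [if_neg (fun h' => absurd h'.1 (by omega)), if_neg (fun h' => absurd h'.1 (by omega)),
              if_neg (fun h' => absurd h'.1 (by omega))]
            ring
          · obtain rfl : e = n + 2 := by omega
            rw [if_pos ⟨by omega, ⟨n + 2, by omega⟩⟩, if_neg (fun h' => absurd h'.1 (by omega)),
              if_pos ⟨by omega, ⟨n + 3, by omega⟩⟩,
              show (n + 2 - (n + 2)) / 2 = 0 by omega, show (n + 3 - (n + 2 + 1)) / 2 = 0 by omega]
            unfold chebyshevMonomialCoeff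
            rw [show n + 2 - 0 - 1 = n + 1 by omega, show n + 2 - 2 * 0 = n + 2 by omega,
              show n + 3 - 0 - 1 = n + 2 by omega, show n + 3 - 2 * 0 = n + 3 by omega,
              Nat.factorial_succ (n + 2), Nat.factorial_succ (n + 1)]
            push_cast
            field_simp
            ring
      · rw [if_neg (fun h => hp (by have := h.2; rw [Nat.even_iff] at this ⊢; omega)),
          if_neg (fun h => hp (by have := h.2; rw [Nat.even_iff] at this ⊢; omega)),
          if_neg (fun h => hp (by have := h.2; rw [Nat.even_iff] at this ⊢; omega))]
        ring

/-- **`T_m` in the monomial basis** (`m ≥ 1`):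
`T_m(x) = (m/2) Σ_{k ≤ m/2} (-1)^k (m-k-1)!/(k! (m-2k)!) (2x)^{m-2k}`.
[cite: AbramowitzStegun1964, 22.3.6] -/
theorem chebyshev_T_eq_sum_monomial {m : ℕ} (hm : 1 ≤ m) :
    Chebyshev.T ℝ m = ∑ k ∈ range (m / 2 + 1), C (chebyshevMonomialCoeff m k) * X ^ (m - 2 * k) := by
  ext e
  rw [coeff_chebyshev_T hm, finsetSum_coeff]
  simp only [coeff_C_mul, coeff_X_pow]
  split_ifs with h
  · obtain ⟨he, hp⟩ := h
    rw [Nat.even_iff] at hp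
    rw [sum_eq_single ((m - e) / 2)]
    · rw [if_pos (by omega), mul_one]
    · intro k hk hne
      rw [mem_range] at hk
      rw [if_neg (by omega), mul_zero]
    · intro h'
      rw [mem_range] at h'
      omega
  · symm
    refine sum_eq_zero fun k hk => ?_
    rw [mem_range] at hk
    rw [if_neg, mul_zero]
    intro heq
    exact h ⟨by omega, ⟨m - k, by omega⟩⟩

/-! ### `λ_j(Q P_a)` selection rules and the structure of the `T^S` table -/

/-- `λ_j(Q P_a) = 0` when `deg Q + j < a` (orthogonality). [cite: AndrewsAskeyRoy1999, (2.5.14)] -/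
theorem legendreCoeff_mul_legendre_eq_zero_of_lt {Q : ℝ[X]} {a j : ℕ} (h : Q.natDegree + j < a) :
    legendreCoeff (Q * legendre a) j = 0 := by
  have h1 := integral_legendre_mul_legendre_mul a j Q
  have h2 : (∫ x in (-1 : ℝ)..1, (legendre a).eval x * (legendre j).eval x * Q.eval x) =
      ∫ x in (-1 : ℝ)..1, (legendre j).eval x * (legendre a).eval x * Q.eval x :=
    intervalIntegral.integral_congr fun x _ => by ring
  rw [h2, integral_legendre_mul_legendre_mul_eq_zero_of_lt h] at h1
  have h3 : (2 : ℝ) / (2 * j + 1) ≠ 0 := by positivity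
  exact (mul_eq_zero.mp h1.symm).resolve_left h3

/-- `λ_j(Q P_a) = 0` for `Q` even and `a + j` odd (parity). [cite: Arfken1985, (12.37)] -/
theorem legendreCoeff_mul_legendre_eq_zero_of_odd {Q : ℝ[X]} {a j : ℕ} (hQ : ∀ x, Q.eval (-x) = Q.eval x)
    (h : Odd (a + j)) : legendreCoeff (Q * legendre a) j = 0 := by
  have h1 := integral_legendre_mul_legendre_mul a j Q
  rw [integral_legendre_mul_legendre_mul_eq_zero_of_odd hQ h] at h1
  have h3 : (2 : ℝ) / (2 * j + 1) ≠ 0 := by positivity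
  exact (mul_eq_zero.mp h1.symm).resolve_left h3

/-- **Method G for `T^S`** (`triple_TS_gaunt`): with `g_i = λ_i(Q)` (`deg Q ≤ m`),
`∫_{-1}^1 (1-x²) P'_l P'_{l'} Q = (l(l+1)/(2l+1)) Σ_{j<l', j≡l'-1 (2)} (2j+1) Σ_{i≤m} g_i [2(l-1 j i)² - 2(l+1 j i)²]`
(squared 3j-symbols; for `l = 0` the prefactor vanishes). [cite: DLMF, 34.3.21 (m = 0); Arfken1985, (12.23)] -/
theorem integral_one_sub_sq_mul_derivative_legendre_mul_eq_sum_threeJZeroSq (l l' : ℕ) {Q : ℝ[X]}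
    {m : ℕ} (hQ : Q.natDegree ≤ m) :
    ∫ x in (-1 : ℝ)..1, (1 - x ^ 2) * (derivative (legendre l)).eval x *
        (derivative (legendre l')).eval x * Q.eval x =
      l * (l + 1) / (2 * l + 1) *
        ∑ j ∈ (range l').filter (fun j => (j + l') % 2 = 1), (2 * j + 1) *
          ∑ i ∈ range (m + 1), legendreCoeff Q i *
            (2 * threeJZeroSq (l - 1) j i - 2 * threeJZeroSq (l + 1) j i) := by
  rw [integral_one_sub_sq_mul_derivative_legendre_mul, mul_sum, mul_sum]
  refine sum_congr rfl fun j _ => ?_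
  have key : ∀ a : ℕ, legendreCoeff (Q * legendre a) j =
      (2 * j + 1) / 2 * ∑ i ∈ range (m + 1), legendreCoeff Q i * (2 * threeJZeroSq a j i) := by
    intro a
    have hdef : legendreCoeff (Q * legendre a) j =
        (2 * j + 1) / 2 * ∫ x in (-1 : ℝ)..1, (Q * legendre a).eval x * (legendre j).eval x := rfl
    rw [hdef, ← integral_legendre_mul_legendre_mul_eq_sum_threeJZeroSq a j hQ]
    congr 1
    exact intervalIntegral.integral_congr fun x _ => by simp only [eval_mul]; ring
  rw [key, key, ← mul_sub, ← sum_sub_distrib]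
  simp_rw [mul_sub]
  ring

/-- **The structural identities of the table `T^S_L[l,l'] = ∫ (1-x²) P'_l P'_{l'} T_{2L}`** checked by
the program's `crosscheck_tables`: symmetry, the selection rule `|l - l'| ≤ 2L`, the parity rule
`l + l'` even, and the `L = 0` values `(2l(l+1)/(2l+1)) δ_{ll'}`. [cite: AndrewsAskeyRoy1999, (2.5.14); Arfken1985, (12.37); DLMF, Table 18.6.1] -/
theorem integral_one_sub_sq_mul_derivative_legendre_mul_chebyshev_T (L l l' : ℕ) :
    (∫ x in (-1 : ℝ)..1, (1 - x ^ 2) * (derivative (legendre l)).eval x *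
        (derivative (legendre l')).eval x * (Chebyshev.T ℝ (2 * L)).eval x =
      ∫ x in (-1 : ℝ)..1, (1 - x ^ 2) * (derivative (legendre l')).eval x *
        (derivative (legendre l)).eval x * (Chebyshev.T ℝ (2 * L)).eval x) ∧
    (l + 2 * L < l' →
      ∫ x in (-1 : ℝ)..1, (1 - x ^ 2) * (derivative (legendre l)).eval x *
        (derivative (legendre l')).eval x * (Chebyshev.T ℝ (2 * L)).eval x = 0) ∧
    (Odd (l + l') →
      ∫ x in (-1 : ℝ)..1, (1 - x ^ 2) * (derivative (legendre l)).eval x *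
        (derivative (legendre l')).eval x * (Chebyshev.T ℝ (2 * L)).eval x = 0) ∧
    (∫ x in (-1 : ℝ)..1, (1 - x ^ 2) * (derivative (legendre l)).eval x *
        (derivative (legendre l')).eval x * (Chebyshev.T ℝ (2 * 0)).eval x =
      if l = l' then 2 * (l : ℝ) * (l + 1) / (2 * l + 1) else 0) := by
  have hdeg : (Chebyshev.T ℝ (2 * L)).natDegree = 2 * L := by
    rw [Chebyshev.natDegree_T]; omega
  have hsymm : ∀ a b : ℕ, (∫ x in (-1 : ℝ)..1, (1 - x ^ 2) * (derivative (legendre a)).eval x *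
      (derivative (legendre b)).eval x * (Chebyshev.T ℝ (2 * L)).eval x) =
      ∫ x in (-1 : ℝ)..1, (1 - x ^ 2) * (derivative (legendre b)).eval x *
        (derivative (legendre a)).eval x * (Chebyshev.T ℝ (2 * L)).eval x :=
    fun a b => intervalIntegral.integral_congr fun x _ => by ring
  refine ⟨hsymm l l', fun h => ?_, fun h => ?_, ?_⟩
  · rw [hsymm, integral_one_sub_sq_mul_derivative_legendre_mul]
    refine mul_eq_zero_of_right _ (sum_eq_zero fun j hj => ?_)
    rw [mem_filter, mem_range] at hj
    rw [legendreCoeff_mul_legendre_eq_zero_of_lt (by rw [hdeg]; omega),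
      legendreCoeff_mul_legendre_eq_zero_of_lt (by rw [hdeg]; omega), sub_zero]
  · rcases Nat.eq_zero_or_pos l with rfl | hl
    · rw [integral_one_sub_sq_mul_derivative_legendre_mul]
      simp
    · rw [integral_one_sub_sq_mul_derivative_legendre_mul]
      refine mul_eq_zero_of_right _ (sum_eq_zero fun j hj => ?_)
      rw [mem_filter, mem_range] at hj
      have ho := Nat.odd_iff.mp h
      rw [legendreCoeff_mul_legendre_eq_zero_of_odd (eval_neg_chebyshev_T_two_mul L)
          (Nat.odd_iff.mpr (by omega)),
        legendreCoeff_mul_legendre_eq_zero_of_odd (eval_neg_chebyshev_T_two_mul L)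
          (Nat.odd_iff.mpr (by omega)), sub_zero]
  · simp only [mul_zero, Chebyshev.T_zero, eval_one, mul_one]
    exact integral_one_sub_sq_mul_derivative_legendre_mul_derivative_legendre l l'

end Literature.Analysis.SpecialFunctions
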